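import Literature.NumberTheory.LFunctions.FordZetaBoundMain
import Literature.NumberTheory.LFunctions.RealCharacterPartialSums
import Literature.NumberTheory.LFunctions.VinogradovKorobovFromRichert
import Mathlib.Analysis.SumIntegralComparisons
import HarnessLib

/-!
# Richert-type bounds for `ζ(s)` and `L(s, χ)` from Vinogradov's exponential-sum estimate, and the
# Vinogradov–Korobov zero-free region from it

Topic `Literature/NumberTheory/LFunctions`.  Everything in this file is PROVED; no named fact is
introduced (the `def`s are the parametrised hypothesis `ExpSumBound C D` and the exponent constant
`RichertFromExpSum.Bexp D`).

**Input.** `ExpSumBound C D`: for all integers `1 ≤ N < R ≤ 2N`, reals `t ≥ N` and shifts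
`0 < u ≤ 1`, `‖∑_{N < n ≤ R} (n + u)^{−it}‖ ≤ C N^{1 − (log N)²/(D log² t)}` — Theorem 2 of K. Ford,
*Vinogradov's integral and bounds for the Riemann zeta function*, Proc. LMS 85 (2002) (there with
`(C, D) = (9.463, 133.66)`; `FordZetaBoundMain.lean` uses exactly this shape), i.e. Vinogradov's
estimate for the zeta sums with unspecified constants.

**Output** (Ford's Lemma 7.3 and Corollary 2A without the optimisation of the sum over dyadic
blocks, so with `log t` in place of `log^{2/3} t`):

* `RichertFromExpSum.richertTypeBound_of_expSumBound` —
  `RichertTypeBound (252 + 4C) (max(4.45, B_D)) 1`: `|ζ(σ + it)| ≤ A|t|^{B(1−σ)^{3/2}} log|t|`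
  (`|t| ≥ 3`, `1/2 ≤ σ ≤ 1`), `B_D = (2/9)√(3D)` (`Bexp`);
* `RichertFromExpSum.richertTypeBoundL_of_expSumBound` —
  `RichertTypeBoundL (252 + 4C) (max(4.45, B_D)) 1`:
  `|L(σ + it, χ)| ≤ A q^{1−σ}(1 + log q)|t|^{B(1−σ)^{3/2}} log|t|` for every `χ ≠ χ₀` mod `q`;
* `hasVKZeroFreeRegion_of_expSumBound` — **`ExpSumBound C D ⟹ ∃ c > 0, HasVKZeroFreeRegion c 21`**
  (through `hasVKZeroFreeRegion_of_richertType`, `VinogradovKorobovFromRichert.lean`), and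
  `zeta_zeroFree_of_expSumBound` for `ζ` alone.

So the Vinogradov–Korobov input of the chain `HasVKZeroFreeRegion → twisted prime number theorem →
Matomäki–Radziwiłł–Tao (1.12) / Lichtman's Lemma 4.5` is reduced to `ExpSumBound C D` for SOME
`C, D`, i.e. to Vinogradov's mean value theorem and the Korobov–Vinogradov estimate for
`∑ (n + u)^{−it}` (Ford 2002, §§2–6; Ivić, *The Riemann Zeta-Function*, Ch. 6).

## Proofs

* `ζ` (`norm_zeta_le_of_expSumBound`): Ford's crude Lemma 7.1 for `σ ≤ 15/16` or `t ≤ e^{300}`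
  (`FordVK.zeta_bound_ford_crude`); otherwise `|ζ(s) − ∑_{n ≤ t} n^{-s}| ≤ 1`
  (`FordVK.norm_zeta_sub_sum_le_one`) and the `≤ 2 log t` dyadic blocks of `∑_{1 < n ≤ t} n^{-s}`
  are each `≤ N^{-σ} C N^{1 − (log N)²/(D log² t)} = C e^{g}`, `g = (1−σ)v − v³/(D log² t)`
  (`v = log N`), and `g ≤ B_D(1−σ)^{3/2} log t` (`cubic_bound`: `3ρ²v − v³ ≤ 2ρ³`).
* `L(s, χ)`, `χ ≠ χ₀`, main range `σ ≥ 15/16`, `t ≥ e^{300}` (`norm_LFunction_le_main`): one Abel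
  summation `L(s, χ) = ∑_{n ≤ qM} χ(n) n^{-s} + O(q (qM)^{-σ}(1 + |s|/σ))` (`M = ⌊t⌋²`;
  `norm_LFunction_sub_sum_range_le`, from `DirichletAbel.LFunction_sub_sum_eq` and the integral test
  `tsum_rpow_tail_le`), the residue-class decomposition `∑_{n ≤ qM} χ(n)n^{-s} =
  q^{-s}∑_{ℓ ≤ q} χ(ℓ) ∑_{0 ≤ m < M}(m + ℓ/q)^{-s}` (Ford's Corollary 2A), and for each shift
  `u = ℓ/q ∈ (0, 1]`: dyadic blocks with `N ≤ t` by the hypothesis and partial summation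
  (`VdC.abel_bound`), blocks with `t < N ≤ t²` by the Kusmin–Landau inequality for the shifted phase
  (`norm_shifted_sum_le_of_height_lt`, `VdC.kusminLandau`: `≤ 101 N/t`), `≤ 4 log t` blocks in all
  (`norm_shifted_Ioc_le`, `norm_range_shifted_le`); finally `∑_{ℓ ≤ q} ℓ^{-σ} ≤ q^{1−σ}(1 + log q)`.
  Crude ranges (`norm_LFunction_le_crude`, `rpow_crude_le`): `|L| ≤ 12 q^{1−σ}(1 + log q) log t · t^{1−σ}`
  and `t^{1−σ} ≤ 21 t^{B(1−σ)^{3/2}}` there (Ford, proof of Lemma 7.1: `1 − σ − 4(1−σ)^{3/2} ≤ 1/108`).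
  Negative `t` by `L(s̄, χ) = conj L(s, χ̄)`.

## References

* K. Ford, *Vinogradov's integral and bounds for the Riemann zeta function*, Proc. London Math. Soc.
  (3) 85 (2002), 565–633 = arXiv:1910.08209: Theorem 2, Corollary 2A, Lemmas 7.1–7.3. [Ford2002]
* H. L. Montgomery, R. C. Vaughan, *Multiplicative Number Theory I*, §1.3 Thm 1.3, §4.3 (4.23).
  [MontgomeryVaughan2007]
* S. W. Graham, G. Kolesnik, *Van der Corput's Method of Exponential Sums*, Thm 2.1 (Kusmin–Landau),
  via the tree's `VdC.kusminLandau`. [GrahamKolesnik1991]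
* E. C. Titchmarsh, *The Theory of the Riemann Zeta-Function*, 2nd ed., Theorem 3.10, §6.19.
  [Titchmarsh1986]

## Design notes

* Constants are explicit but crude (`A = 252 + 4C`, `B = max(4.45, (2/9)√(3D))`, `P = 1`); the
  consumer (`hasVKZeroFreeRegion_of_richertType`) only needs some `(A, B, P)`.
* The `log^{2/3}` of Ford's Theorem 1 would need the finer treatment of the sum over blocks
  (`FordVK.dyadic_sum_le`); it is not needed for the zero-free region and is not attempted.
-/

noncomputable section

open Complex Finset

namespace Literature.NumberTheory.LFunctions

/-- **Vinogradov's exponential-sum estimate in the shape of Ford's Theorem 2** (Ford, *Proc. LMS*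
85 (2002), Theorem 2: `S(N, t) ≤ 9.463 N^{1 − 1/(133.66 λ²)}`, `λ = log t/log N`; Khale (2.5)), with
unspecified constants `(C, D)`: for all integers `1 ≤ N < R ≤ 2N`, reals `t ≥ N` and shifts
`0 < u ≤ 1`, `‖∑_{N < n ≤ R} (n + u)^{−it}‖ ≤ C N^{1 − (log N)²/(D (log t)²)}`.  This is the input of
Ford's Lemma 7.3 (`FordZetaBoundMain.lean` is the case `(C, D) = (9.463, 133.66)`); a predicate in
`(C, D)`, not a named fact. [cite: Ford2002, Theorem 2] -/
def ExpSumBound (C D : ℝ) : Prop :=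
  ∀ (N R : ℕ) (t u : ℝ), 1 ≤ N → (N : ℝ) ≤ t → 0 < u → u ≤ 1 → N < R → R ≤ 2 * N →
    ‖∑ n ∈ Finset.Ioc N R, ((n : ℂ) + u) ^ (-(t * I))‖ ≤
      C * (N : ℝ) ^ (1 - Real.log N ^ 2 / (D * Real.log t ^ 2))

namespace RichertFromExpSum

/-- The exponent constant `B_D = (2/3)√(D/3)` (`= (2/9)√(3D)`, Ford's `B` in Lemma 7.3).
[cite: Ford2002, Lemma 7.3] -/
def Bexp (D : ℝ) : ℝ := 2 / 3 * Real.sqrt (D / 3)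

/-- `B_D ≥ 0`. [folklore] -/
theorem Bexp_nonneg (D : ℝ) : 0 ≤ Bexp D := by unfold Bexp; positivity

/-- **The maximum of the dyadic exponent** (Ford, proof of Lemma 7.3: `g(x) = (1−σ)x log 2 −
(x log 2)³/(D log²t)` is maximal at `x₀`, `g(x₀) = B(1−σ)^{3/2} log t`): for `m, v ≥ 0`,
`m v − v³/(D L²) ≤ B_D m^{3/2} L` (with `ρ² = DL²m/3`: `3ρ²v − v³ − 2ρ³ = −(v − ρ)²(v + 2ρ) ≤ 0`).
[cite: Ford2002, Lemma 7.3 (proof)] -/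
theorem cubic_bound {m v D L : ℝ} (hm : 0 ≤ m) (hv : 0 ≤ v) (hD : 0 < D) (hL : 0 < L) :
    m * v - v ^ 3 / (D * L ^ 2) ≤ Bexp D * m ^ (3 / 2 : ℝ) * L := by
  set ρ : ℝ := Real.sqrt (D * L ^ 2 * m / 3) with hρ
  have hρ0 : 0 ≤ ρ := Real.sqrt_nonneg _
  have hρ2 : ρ ^ 2 = D * L ^ 2 * m / 3 := by
    rw [hρ]; exact Real.sq_sqrt (by positivity)
  have hDL : 0 < D * L ^ 2 := by positivity
  -- `3ρ² v − v³ ≤ 2ρ³`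
  have hkey : 3 * ρ ^ 2 * v - v ^ 3 ≤ 2 * ρ ^ 3 := by
    nlinarith [mul_nonneg (sq_nonneg (v - ρ)) (by positivity : 0 ≤ v + 2 * ρ)]
  -- divide by `D L²`
  have h1 : m * v - v ^ 3 / (D * L ^ 2) = (3 * ρ ^ 2 * v - v ^ 3) / (D * L ^ 2) := by
    rw [hρ2]; field_simp
  have h2 : 2 * ρ ^ 3 / (D * L ^ 2) = 2 / 3 * ρ * m := by
    have : ρ ^ 3 = ρ * ρ ^ 2 := by ring
    rw [this, hρ2]; field_simp
  rw [h1]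
  calc (3 * ρ ^ 2 * v - v ^ 3) / (D * L ^ 2) ≤ 2 * ρ ^ 3 / (D * L ^ 2) :=
        div_le_div_of_nonneg_right hkey hDL.le
    _ = 2 / 3 * ρ * m := h2
    _ = Bexp D * m ^ (3 / 2 : ℝ) * L := by
        -- `ρ = L √(D/3) √m`, `m^{3/2} = m √m`
        have hρ' : ρ = L * Real.sqrt (D / 3) * Real.sqrt m := by
          rw [hρ, show D * L ^ 2 * m / 3 = L ^ 2 * (D / 3) * m by ring,
            Real.sqrt_mul (by positivity) m, Real.sqrt_mul (by positivity) (D / 3),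
            Real.sqrt_sq hL.le]
        have hm32 : m ^ (3 / 2 : ℝ) = m * Real.sqrt m := by
          rw [show (3 / 2 : ℝ) = 1 + 1 / 2 by norm_num, Real.rpow_add' hm (by norm_num),
            Real.rpow_one, Real.sqrt_eq_rpow]
        rw [hρ', hm32, Bexp]; ring

/-- `(2^i)^x` against the exponent: `(2^i)^{-σ} · (2^i)^{1 − (log 2^i)²/(DL²)} = e^{m v − v³/(DL²)}`
with `v = i log 2`, `m = 1 − σ`. [folklore] -/
theorem dyadic_term_eq (σ D L : ℝ) (i : ℕ) :
    ((2 : ℝ) ^ i) ^ (-σ) * ((2 : ℝ) ^ i) ^ (1 - Real.log ((2 : ℝ) ^ i) ^ 2 / (D * L ^ 2)) =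
      Real.exp ((1 - σ) * (i * Real.log 2) - (i * Real.log 2) ^ 3 / (D * L ^ 2)) := by
  rw [FordVK.two_pow_rpow, FordVK.two_pow_rpow, ← Real.exp_add, Real.log_pow]
  congr 1
  have e : (i * Real.log 2) ^ 3 / (D * L ^ 2) = (i * Real.log 2) ^ 2 / (D * L ^ 2) * (i * Real.log 2) := by
    ring
  rw [e]
  ring

/-- `log 2 > 0.69`, so `1/log 2 < 1.45`. [folklore] -/
theorem inv_log_two_lt : 1 / Real.log 2 < 1.45 := by
  have h := Real.log_two_gt_d9
  rw [div_lt_iff₀ (by linarith)]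
  linarith

/-- The number of dyadic blocks: `Nat.log 2 N + 1 ≤ 2 log t` for `1 ≤ N ≤ t`, `log t ≥ 4`. [folklore] -/
theorem log_two_nat_add_one_le {N : ℕ} {t : ℝ} (hN : 1 ≤ N) (hNt : (N : ℝ) ≤ t)
    (hL : 4 ≤ Real.log t) : (Nat.log 2 N : ℝ) + 1 ≤ 2 * Real.log t := by
  have hN0 : (0 : ℝ) < N := by exact_mod_cast hN
  have h2J : ((2 : ℕ) ^ Nat.log 2 N : ℕ) ≤ N := Nat.pow_log_le_self 2 (by omega)
  have h2J' : (2 : ℝ) ^ Nat.log 2 N ≤ N := by exact_mod_cast h2J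
  have hlog := Real.log_le_log (by positivity) (h2J'.trans hNt)
  rw [Real.log_pow] at hlog
  have hl2 := Real.log_two_gt_d9
  have hJ : (Nat.log 2 N : ℝ) ≤ Real.log t / Real.log 2 := by
    rw [le_div_iff₀ (by linarith)]; linarith
  have h2 : Real.log t / Real.log 2 ≤ 1.45 * Real.log t := by
    rw [div_le_iff₀ (by linarith)]; nlinarith
  linarith

/-- **The Richert-type bound for `ζ` from the exponential-sum estimate, crude form** (`P = 1`):
if `ExpSumBound C D` (`C ≥ 0`, `D > 0`), then for `t ≥ 3`, `1/2 ≤ σ ≤ 1`,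
`|ζ(σ + it)| ≤ (77 + 2C) t^{B(1−σ)^{3/2}} log t` with `B = max(4.45, B_D)`.  The ranges
`σ ≤ 15/16` or `t ≤ e^{300}` are Ford's Lemma 7.1 (`FordVK.zeta_bound_ford_crude`, `A = 76.2`,
`B = 4.45`); in the main range `|ζ(s) − ∑_{n ≤ t} n^{-s}| ≤ 1` (`FordVK.norm_zeta_sub_sum_le_one`) and
each of the `≤ 2 log t` dyadic blocks of `∑_{1 < n ≤ t} n^{-s}` is, by partial summation and the
hypothesis at `u → 0⁺`, at most `C e^{g(i)} ≤ C t^{B_D(1−σ)^{3/2}}` (`cubic_bound`) — Ford's Lemma 7.3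
without the optimisation of the sum over blocks. [cite: Ford2002, Lemma 7.3 (proof)] -/
theorem norm_zeta_le_of_expSumBound {C D : ℝ} (h : ExpSumBound C D) (hC : 0 ≤ C) (hD : 0 < D)
    {σ t : ℝ} (ht : 3 ≤ t) (hσ : 1 / 2 ≤ σ) (hσ1 : σ ≤ 1) :
    ‖riemannZeta (σ + t * I)‖ ≤
      (77 + 2 * C) * t ^ (max 4.45 (Bexp D) * (1 - σ) ^ (3 / 2 : ℝ)) * Real.log t ^ (1 : ℝ) := by
  set B : ℝ := max 4.45 (Bexp D) with hBdef
  have hB45 : 4.45 ≤ B := le_max_left _ _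
  have hBD : Bexp D ≤ B := le_max_right _ _
  set m : ℝ := 1 - σ with hmdef
  have hm0 : 0 ≤ m := by rw [hmdef]; linarith
  have hm32 : 0 ≤ m ^ (3 / 2 : ℝ) := Real.rpow_nonneg hm0 _
  have ht0 : 0 < t := by linarith
  have ht1 : 1 ≤ t := by linarith
  set L : ℝ := Real.log t with hLdef
  have hL1 : 1 ≤ L := by
    rw [hLdef, ← Real.log_exp 1]
    exact Real.log_le_log (Real.exp_pos 1) (by have := Real.exp_one_lt_d9; linarith)
  have hL0 : 0 < L := by linarith
  rw [Real.rpow_one]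
  have htB1 : 1 ≤ t ^ (B * m ^ (3 / 2 : ℝ)) := Real.one_le_rpow ht1 (by positivity)
  have hmono : t ^ (4.45 * m ^ (3 / 2 : ℝ)) ≤ t ^ (B * m ^ (3 / 2 : ℝ)) :=
    Real.rpow_le_rpow_of_exponent_le ht1 (mul_le_mul_of_nonneg_right hB45 hm32)
  have hlog23 : L ^ (2 / 3 : ℝ) ≤ L := by
    calc L ^ (2 / 3 : ℝ) ≤ L ^ (1 : ℝ) := Real.rpow_le_rpow_of_exponent_le hL1 (by norm_num)
      _ = L := Real.rpow_one L
  by_cases hcase : σ ≤ 15 / 16 ∨ t ≤ Real.exp 300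
  · -- Ford's crude range
    have hcr := FordVK.zeta_bound_ford_crude ht hσ hσ1 hcase
    have h0 : 0 ≤ t ^ (4.45 * m ^ (3 / 2 : ℝ)) := by positivity
    calc ‖riemannZeta (σ + t * I)‖ ≤ 76.2 * t ^ (4.45 * m ^ (3 / 2 : ℝ)) * L ^ (2 / 3 : ℝ) := hcr
      _ ≤ 76.2 * t ^ (B * m ^ (3 / 2 : ℝ)) * L := by gcongr
      _ ≤ (77 + 2 * C) * t ^ (B * m ^ (3 / 2 : ℝ)) * L := by gcongr; linarith
  · rw [not_or, not_le, not_le] at hcase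
    obtain ⟨hσ15, ht300⟩ := hcase
    have hL300 : 300 ≤ L := by
      rw [hLdef, ← Real.log_exp 300]; exact Real.log_le_log (Real.exp_pos _) ht300.le
    -- `|ζ(s) − ∑_{n ≤ t} n^{-s}| ≤ 1`
    have htail := FordVK.norm_zeta_sub_sum_le_one hσ15.le hσ1 ht300.le
    set N₁ : ℕ := ⌊t⌋₊ with hN₁
    have hN₁t : (N₁ : ℝ) ≤ t := Nat.floor_le ht0.le
    have hN₁1 : 1 ≤ N₁ := Nat.le_floor (by simpa using ht1)
    set s : ℂ := (σ : ℂ) + t * I with hsdef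
    -- the unshifted hypothesis
    have hS : ∀ N R : ℕ, 1 ≤ N → (N : ℝ) ≤ t → N < R → R ≤ 2 * N →
        ‖∑ n ∈ Finset.Ioc N R, (n : ℂ) ^ (-(t * I))‖ ≤
          C * (N : ℝ) ^ (1 - Real.log N ^ 2 / (D * L ^ 2)) :=
      fun N R hN hNt hNR hR2 ↦ FordVK.norm_sum_Ioc_cpow_le_of_shifted
        fun u hu0 hu1 ↦ h N R t u hN hNt hu0 hu1 hNR hR2
    -- dyadic decomposition of `∑_{1 < n ≤ N₁} n^{-s}`
    set J : ℕ := Nat.log 2 N₁ with hJ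
    have h2J : N₁ ≤ 1 * 2 ^ (J + 1) := by
      rw [one_mul]; exact (Nat.lt_pow_succ_log_self one_lt_two N₁).le
    set G : ℕ → ℝ := fun N ↦ (N : ℝ) ^ (-σ) * (C * (N : ℝ) ^ (1 - Real.log N ^ 2 / (D * L ^ 2)))
      with hG
    have hG0 : ∀ N, 0 ≤ G N := fun N ↦ by rw [hG]; positivity
    have hσ0 : 0 ≤ σ := by linarith
    have hblock : ∀ i : ℕ, 1 * 2 ^ i < N₁ →
        ‖∑ n ∈ Finset.Ioc (1 * 2 ^ i) (min (1 * 2 ^ (i + 1)) N₁), (n : ℂ) ^ (-((σ : ℂ) + t * I))‖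
          ≤ G (1 * 2 ^ i) := by
      intro i hi
      rw [one_mul] at hi ⊢
      rw [one_mul]
      have hN : 1 ≤ 2 ^ i := Nat.one_le_two_pow
      have hNx : 2 ^ i ≤ min (2 ^ (i + 1)) N₁ :=
        le_min (Nat.pow_le_pow_right (by norm_num) (by omega)) hi.le
      have hx2 : min (2 ^ (i + 1)) N₁ ≤ 2 * 2 ^ i := (min_le_left _ _).trans (le_of_eq (by ring))
      have hNt : ((2 ^ i : ℕ) : ℝ) ≤ t := le_trans (by exact_mod_cast hi.le) hN₁t
      refine FordVK.norm_block_le_of_partial hσ0 (by positivity) hN hNx fun y hy1 hy2 ↦ ?_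
      exact hS (2 ^ i) y hN hNt hy1 (hy2.trans hx2)
    have hdy := VdC.dyadic_bound (fun n : ℕ ↦ (n : ℂ) ^ (-((σ : ℂ) + t * I))) G hG0 N₁ (J + 1) 1
      hblock h2J
    -- each block is `≤ C t^{B m^{3/2}}`
    have hexpB : Real.exp (Bexp D * m ^ (3 / 2 : ℝ) * L) ≤ t ^ (B * m ^ (3 / 2 : ℝ)) := by
      rw [Real.rpow_def_of_pos ht0, ← hLdef, Real.exp_le_exp]
      have := mul_le_mul_of_nonneg_right hBD hm32
      nlinarith
    have hGle : ∀ i : ℕ, G (1 * 2 ^ i) ≤ C * t ^ (B * m ^ (3 / 2 : ℝ)) := by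
      intro i
      rw [hG, one_mul]
      simp only [Nat.cast_pow, Nat.cast_ofNat]
      rw [mul_left_comm, dyadic_term_eq]
      refine mul_le_mul_of_nonneg_left ?_ hC
      refine le_trans ?_ hexpB
      rw [Real.exp_le_exp, ← hmdef]
      exact cubic_bound hm0 (by positivity) hD hL0
    have hsumG : ∑ i ∈ Finset.range (J + 1), G (1 * 2 ^ i) ≤ (2 * L) * (C * t ^ (B * m ^ (3 / 2 : ℝ))) := by
      calc ∑ i ∈ Finset.range (J + 1), G (1 * 2 ^ i)
          ≤ ∑ _i ∈ Finset.range (J + 1), C * t ^ (B * m ^ (3 / 2 : ℝ)) := Finset.sum_le_sum fun i _ ↦ hGle i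
        _ = ((J : ℝ) + 1) * (C * t ^ (B * m ^ (3 / 2 : ℝ))) := by
            rw [Finset.sum_const, Finset.card_range, nsmul_eq_mul]; push_cast; ring
        _ ≤ (2 * L) * (C * t ^ (B * m ^ (3 / 2 : ℝ))) := by
            refine mul_le_mul_of_nonneg_right ?_ (by positivity)
            exact log_two_nat_add_one_le hN₁1 hN₁t (by linarith)
    -- `∑_{n ∈ Icc 1 N₁} = 1 + ∑_{n ∈ Ioc 1 N₁}`
    have hsplit : ∑ n ∈ Finset.Icc 1 N₁, (n : ℂ) ^ (-((σ : ℂ) + t * I)) =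
        1 + ∑ n ∈ Finset.Ioc 1 N₁, (n : ℂ) ^ (-((σ : ℂ) + t * I)) := by
      rw [Finset.Icc_eq_cons_Ioc hN₁1, Finset.sum_cons, Nat.cast_one, Complex.one_cpow]
    have hIcc : ‖∑ n ∈ Finset.Icc 1 N₁, (n : ℂ) ^ (-((σ : ℂ) + t * I))‖ ≤
        1 + (2 * L) * (C * t ^ (B * m ^ (3 / 2 : ℝ))) := by
      rw [hsplit]
      refine (norm_add_le _ _).trans ?_
      rw [norm_one]
      linarith [hdy.trans hsumG]
    have hζ : ‖riemannZeta (σ + t * I)‖ ≤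
        ‖riemannZeta (σ + t * I) - ∑ n ∈ Finset.Icc 1 N₁, (n : ℂ) ^ (-((σ : ℂ) + t * I))‖ +
          ‖∑ n ∈ Finset.Icc 1 N₁, (n : ℂ) ^ (-((σ : ℂ) + t * I))‖ := norm_le_norm_sub_add _ _
    have hX0 : 0 ≤ t ^ (B * m ^ (3 / 2 : ℝ)) := by positivity
    have h77 : (2 : ℝ) ≤ 77 * t ^ (B * m ^ (3 / 2 : ℝ)) * L := by nlinarith
    calc ‖riemannZeta (σ + t * I)‖ ≤ 1 + (1 + (2 * L) * (C * t ^ (B * m ^ (3 / 2 : ℝ)))) := by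
          linarith
      _ = 2 + 2 * C * t ^ (B * m ^ (3 / 2 : ℝ)) * L := by ring
      _ ≤ (77 + 2 * C) * t ^ (B * m ^ (3 / 2 : ℝ)) * L := by nlinarith

/-! ### Shifted sums: identities and the Kusmin–Landau range `N > t` -/

/-- For real `x > 0`: `x^{-(σ+it)} = x^{-σ} · x^{-it}` with the real power as a real number.
[folklore] -/
theorem ofReal_cpow_neg_add {x : ℝ} (hx : 0 < x) (σ t : ℝ) :
    (x : ℂ) ^ (-((σ : ℂ) + t * I)) = (((x ^ (-σ) : ℝ)) : ℂ) * (x : ℂ) ^ (-(t * I)) := by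
  have hx0 : (x : ℂ) ≠ 0 := by exact_mod_cast hx.ne'
  rw [neg_add, Complex.cpow_add _ _ hx0, Complex.ofReal_cpow hx.le, Complex.ofReal_neg]

/-- `e(D₀(x)) = x^{-it}` for real `x > 0` (`D₀(y) = −(t/2π) log y`, `VdC.phaseD t 0`). [folklore] -/
theorem e_phaseD_zero_real (t : ℝ) {x : ℝ} (hx : 0 < x) :
    VdC.e (VdC.phaseD t 0 x) = (x : ℂ) ^ (-(t * I)) := by
  rw [VdC.phaseD_zero, VdC.e, Complex.cpow_def_of_ne_zero (by exact_mod_cast hx.ne'),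
    ← Complex.ofReal_log hx.le]
  congr 1
  have hπ : (Real.pi : ℂ) ≠ 0 := by exact_mod_cast Real.pi_ne_zero
  push_cast
  field_simp

/-- **Kusmin–Landau for shifted zeta sums beyond the height**: for `0 < u ≤ 1`, `1 ≤ t < N` and
`N < y ≤ 2N`, `‖∑_{N < n ≤ y} (n + u)^{-it}‖ ≤ 101 N/t` (the increments of the phase
`−(t/2π) log(n + u)` lie in `[−1/(2π), −t/(4π(2N+2))]` and increase; `VdC.kusminLandau` with
`δ = t/(4π(2N+2))` gives `2/δ ≤ 32πN/t`). [folklore] -/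
theorem norm_shifted_sum_le_of_height_lt {u t : ℝ} (hu0 : 0 < u) (hu1 : u ≤ 1) (ht : 1 ≤ t)
    {N y : ℕ} (hN : t < N) (hy : y ≤ 2 * N) :
    ‖∑ n ∈ Finset.Ioc N y, ((n : ℂ) + u) ^ (-(t * I))‖ ≤ 101 * N / t := by
  have hπ : 3 < Real.pi := Real.pi_gt_three
  have hπ4 : Real.pi < 3.15 := Real.pi_lt_d2
  have ht0 : 0 < t := by linarith
  have hN1 : (1 : ℝ) ≤ N := by linarith
  set δ : ℝ := t / (4 * Real.pi * (2 * N + 2)) with hδdef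
  have hδ0 : 0 < δ := by positivity
  have hδ2 : δ ≤ 1 / 2 := by
    rw [hδdef, div_le_div_iff₀ (by positivity) (by norm_num)]; nlinarith
  -- transfer to an integer-indexed sum of `e(φ(n))`
  have hconv : ∑ n ∈ Finset.Ioc N y, ((n : ℂ) + u) ^ (-(t * I)) =
      ∑ n ∈ Finset.Icc ((N + 1 : ℕ) : ℤ) y, VdC.e (VdC.phaseD t 0 ((n : ℝ) + u)) := by
    rw [VdC.sum_Icc_int_eq_nat, Finset.Icc_add_one_left_eq_Ioc]
    refine Finset.sum_congr rfl fun n hn ↦ ?_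
    have hn0 : (0 : ℝ) < (n : ℝ) + u := by positivity
    rw [Int.cast_natCast, e_phaseD_zero_real t hn0]
    push_cast; ring_nf
  rw [hconv]
  have key := VdC.kusminLandau (φ := fun n : ℤ ↦ VdC.phaseD t 0 ((n : ℝ) + u))
    (m := ((N + 1 : ℕ) : ℤ)) (M := (y : ℤ)) (ν := -1) hδ0 hδ2 ?_ ?_
  · refine key.trans ?_
    rw [hδdef, div_div_eq_mul_div, div_le_div_iff₀ ht0 ht0]
    -- `2 · 4π(2N+2) · t ≤ 101 N t`
    have : 2 * (4 * Real.pi * (2 * (N : ℝ) + 2)) ≤ 101 * N := by nlinarith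
    nlinarith
  · -- increments in `[-1 + δ, -δ]`
    intro n h1 h2
    have hnN : (N : ℝ) + 1 ≤ n := by
      have : ((N + 1 : ℕ) : ℤ) ≤ n := h1
      exact_mod_cast this
    have hny : (n : ℝ) + 1 ≤ y := by
      have : n + 1 ≤ (y : ℤ) := h2
      exact_mod_cast this
    have hy2 : (y : ℝ) ≤ 2 * N := by exact_mod_cast hy
    have hx0 : (0 : ℝ) < (n : ℝ) + u := by linarith
    have hx1 : (0 : ℝ) < (n : ℝ) + 1 + u := by linarith
    have hθ : VdC.phaseD t 0 (((n + 1 : ℤ) : ℝ) + u) - VdC.phaseD t 0 ((n : ℝ) + u) =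
        -(t / (2 * Real.pi)) * Real.log (((n : ℝ) + 1 + u) / ((n : ℝ) + u)) := by
      rw [VdC.phaseD_zero, VdC.phaseD_zero, Real.log_div hx1.ne' hx0.ne']
      push_cast; ring
    rw [hθ]
    have hc : 0 < t / (2 * Real.pi) := by positivity
    have hlog_up : Real.log (((n : ℝ) + 1 + u) / ((n : ℝ) + u)) ≤ 1 / ((n : ℝ) + u) := by
      have := Real.log_le_sub_one_of_pos (by positivity : (0 : ℝ) < ((n : ℝ) + 1 + u) / ((n : ℝ) + u))
      rwa [show ((n : ℝ) + 1 + u) / ((n : ℝ) + u) - 1 = 1 / ((n : ℝ) + u) by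
        field_simp; ring] at this
    have hlog_low : 1 / ((n : ℝ) + 1 + u) ≤ Real.log (((n : ℝ) + 1 + u) / ((n : ℝ) + u)) := by
      have := Real.one_sub_inv_le_log_of_pos
        (by positivity : (0 : ℝ) < ((n : ℝ) + 1 + u) / ((n : ℝ) + u))
      rwa [show 1 - (((n : ℝ) + 1 + u) / ((n : ℝ) + u))⁻¹ = 1 / ((n : ℝ) + 1 + u) by
        field_simp; ring] at this
    constructor
    · -- `-1 + δ ≤ θ`: `(t/2π) log ≤ (t/2π)/(n+u) < 1/(2π) ≤ 1/2 ≤ 1 - δ`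
      have h3 : t / (2 * Real.pi) * Real.log (((n : ℝ) + 1 + u) / ((n : ℝ) + u)) ≤ 1 / 2 := by
        calc t / (2 * Real.pi) * Real.log (((n : ℝ) + 1 + u) / ((n : ℝ) + u))
            ≤ t / (2 * Real.pi) * (1 / ((n : ℝ) + u)) := mul_le_mul_of_nonneg_left hlog_up hc.le
          _ ≤ t / (2 * Real.pi) * (1 / t) := by
              apply mul_le_mul_of_nonneg_left _ hc.le
              exact one_div_le_one_div_of_le ht0 (by linarith)
          _ = 1 / (2 * Real.pi) := by field_simp
          _ ≤ 1 / 2 := by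
              rw [div_le_div_iff₀ (by positivity) (by norm_num)]; linarith
      push_cast
      linarith
    · -- `θ ≤ -δ`: `log ≥ 1/(n+1+u) ≥ 1/(2N+2)`
      have h4 : t / (2 * Real.pi) * (1 / (2 * (N : ℝ) + 2)) ≤
          t / (2 * Real.pi) * Real.log (((n : ℝ) + 1 + u) / ((n : ℝ) + u)) := by
        refine mul_le_mul_of_nonneg_left (le_trans ?_ hlog_low) hc.le
        exact one_div_le_one_div_of_le hx1 (by linarith)
      have h5 : δ ≤ t / (2 * Real.pi) * (1 / (2 * (N : ℝ) + 2)) := by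
        rw [hδdef, div_mul_div_comm, mul_one, div_le_div_iff₀ (by positivity) (by positivity)]
        apply mul_le_mul_of_nonneg_left _ ht0.le
        nlinarith
      push_cast
      linarith
  · -- increments nondecreasing: `log(1 + 1/(n+u))` decreases
    intro n h1 _
    have hnN : (N : ℝ) + 1 ≤ n := by
      have : ((N + 1 : ℕ) : ℤ) ≤ n := h1
      exact_mod_cast this
    have hx0 : (0 : ℝ) < (n : ℝ) + u := by linarith
    have e1 : VdC.phaseD t 0 (((n + 1 : ℤ) : ℝ) + u) - VdC.phaseD t 0 ((n : ℝ) + u) =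
        -(t / (2 * Real.pi)) * Real.log (((n : ℝ) + 1 + u) / ((n : ℝ) + u)) := by
      rw [VdC.phaseD_zero, VdC.phaseD_zero, Real.log_div (by linarith) hx0.ne']
      push_cast; ring
    have e2 : VdC.phaseD t 0 (((n + 2 : ℤ) : ℝ) + u) - VdC.phaseD t 0 (((n + 1 : ℤ) : ℝ) + u) =
        -(t / (2 * Real.pi)) * Real.log (((n : ℝ) + 2 + u) / ((n : ℝ) + 1 + u)) := by
      rw [VdC.phaseD_zero, VdC.phaseD_zero, Real.log_div (by linarith) (by linarith)]
      push_cast; ring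
    rw [e1, e2]
    have hc : 0 < t / (2 * Real.pi) := by positivity
    have hcmp : ((n : ℝ) + 2 + u) / ((n : ℝ) + 1 + u) ≤ ((n : ℝ) + 1 + u) / ((n : ℝ) + u) := by
      rw [div_le_div_iff₀ (by linarith) hx0]; nlinarith
    have hlog := Real.log_le_log (div_pos (by linarith) (by linarith)) hcmp
    nlinarith

/-! ### The tail of `L(s, χ)` beyond a Dirichlet polynomial (one Abel summation) -/

/-- **Integral test for the tail `∑_{n > N} n^{-σ-1} ≤ N^{-σ}/σ`** (`σ > 0`, `N ≥ 1`), in the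
shifted indexing `∑_{i ≥ 0} (i + N + 1)^{-σ-1}`. [folklore] -/
theorem tsum_rpow_tail_le {σ : ℝ} (hσ : 0 < σ) {N : ℕ} (hN : 1 ≤ N) :
    ∑' i : ℕ, ((i + N + 1 : ℕ) : ℝ) ^ (-σ - 1) ≤ (N : ℝ) ^ (-σ) / σ := by
  have hN0 : (0 : ℝ) < N := by exact_mod_cast hN
  refine Real.tsum_le_of_sum_range_le (fun n ↦ by positivity) fun n ↦ ?_
  -- compare with `∫_N^{N+n} x^{-σ-1} dx`
  have hanti : AntitoneOn (fun x : ℝ ↦ x ^ (-σ - 1)) (Set.Icc (N : ℝ) ((N : ℝ) + n)) := by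
    intro x hx y hy hxy
    exact Real.rpow_le_rpow_of_nonpos (hN0.trans_le hx.1) hxy (by linarith)
  have hsum := hanti.sum_le_integral
  have e1 : ∑ i ∈ Finset.range n, ((i + N + 1 : ℕ) : ℝ) ^ (-σ - 1) =
      ∑ i ∈ Finset.range n, ((N : ℝ) + ((i + 1 : ℕ) : ℝ)) ^ (-σ - 1) := by
    refine Finset.sum_congr rfl fun i _ ↦ ?_
    congr 1; push_cast; ring
  rw [e1]
  refine hsum.trans ?_
  have h0 : (0 : ℝ) ∉ Set.uIcc (N : ℝ) ((N : ℝ) + n) := by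
    rw [Set.uIcc_of_le (by simp)]
    intro h; exact absurd h.1 (not_le.2 hN0)
  rw [integral_rpow (Or.inr ⟨by linarith, h0⟩)]
  have e2 : -σ - 1 + 1 = -σ := by ring
  rw [e2]
  have h1 : 0 ≤ ((N : ℝ) + n) ^ (-σ) := by positivity
  -- `((N+n)^{-σ} - N^{-σ})/(-σ) = (N^{-σ} - (N+n)^{-σ})/σ ≤ N^{-σ}/σ`
  have e3 : (((N : ℝ) + n) ^ (-σ) - (N : ℝ) ^ (-σ)) / -σ = ((N : ℝ) ^ (-σ) - ((N : ℝ) + n) ^ (-σ)) / σ := by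
    rw [div_neg, ← neg_div, neg_sub]
  rw [e3]
  exact div_le_div_of_nonneg_right (by linarith) hσ.le

open DirichletAbel in
/-- **The tail of `L(s, χ)` after one Abel summation** (`χ ≠ χ₀` mod `q`, `σ = Re s > 0`,
`N ≥ 1`): `‖L(s, χ) − ∑_{n ≤ N} χ(n) n^{-s}‖ ≤ q N^{-σ}(1 + |s|/σ)`
(`DirichletAbel.LFunction_sub_sum_eq`: the tail is `∑_{n > N} S(n)(n^{-s} − (n+1)^{-s}) − S(N)(N+1)^{-s}`
with `|S(n)| ≤ q`, `|n^{-s} − (n+1)^{-s}| ≤ |s| n^{-σ-1}` and `∑_{n > N} n^{-σ-1} ≤ N^{-σ}/σ`).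
[cite: MontgomeryVaughan2007, §1.3 Thm. 1.3 and §4.3 (4.23)] -/
theorem norm_LFunction_sub_sum_range_le {q : ℕ} [NeZero q] (χ : DirichletCharacter ℂ q)
    (hχ : χ ≠ 1) {s : ℂ} (hs : 0 < s.re) {N : ℕ} (hN : 1 ≤ N) :
    ‖χ.LFunction s - ∑ n ∈ Finset.range N, χ ((n + 1 : ℕ) : ZMod q) * ((n + 1 : ℕ) : ℂ) ^ (-s)‖ ≤
      q * (N : ℝ) ^ (-s.re) * (1 + ‖s‖ / s.re) := by
  rw [LFunction_sub_sum_eq χ hχ hs N]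
  have hN0 : (0 : ℝ) < N := by exact_mod_cast hN
  have hq0 : (0 : ℝ) ≤ q := Nat.cast_nonneg q
  -- boundary term
  have hB : ‖partialSum χ N * ((N + 1 : ℕ) : ℂ) ^ (-s)‖ ≤ q * (N : ℝ) ^ (-s.re) := by
    rw [norm_mul, Complex.norm_natCast_cpow_of_pos (Nat.succ_pos N), Complex.neg_re]
    refine mul_le_mul (norm_partialSum_le χ hχ N) ?_ (by positivity) hq0
    exact Real.rpow_le_rpow_of_nonpos hN0 (by push_cast; linarith) (by linarith)
  -- tail
  have hsumm : Summable fun n ↦ term χ (n + N) s :=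
    (summable_term χ hχ hs).comp_injective (add_left_injective N)
  have hmaj : Summable fun i : ℕ ↦ ((i + N + 1 : ℕ) : ℝ) ^ (-s.re - 1) :=
    (summable_nat_add_iff N).2 (summable_rpow_neg hs)
  have hT : ‖∑' n, term χ (n + N) s‖ ≤ q * ‖s‖ * ((N : ℝ) ^ (-s.re) / s.re) := by
    calc ‖∑' n, term χ (n + N) s‖ ≤ ∑' n, ‖term χ (n + N) s‖ := norm_tsum_le_tsum_norm hsumm.norm
      _ ≤ ∑' n, q * ‖s‖ * ((n + N + 1 : ℕ) : ℝ) ^ (-s.re - 1) :=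
          hsumm.norm.tsum_le_tsum (fun n ↦ norm_term_le χ hχ (n + N) hs) (hmaj.mul_left _)
      _ = q * ‖s‖ * ∑' n, ((n + N + 1 : ℕ) : ℝ) ^ (-s.re - 1) := tsum_mul_left
      _ ≤ q * ‖s‖ * ((N : ℝ) ^ (-s.re) / s.re) :=
          mul_le_mul_of_nonneg_left (tsum_rpow_tail_le hs hN) (by positivity)
  calc ‖∑' n, term χ (n + N) s - partialSum χ N * ((N + 1 : ℕ) : ℂ) ^ (-s)‖
      ≤ ‖∑' n, term χ (n + N) s‖ + ‖partialSum χ N * ((N + 1 : ℕ) : ℂ) ^ (-s)‖ := norm_sub_le _ _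
    _ ≤ q * ‖s‖ * ((N : ℝ) ^ (-s.re) / s.re) + q * (N : ℝ) ^ (-s.re) := add_le_add hT hB
    _ = q * (N : ℝ) ^ (-s.re) * (1 + ‖s‖ / s.re) := by ring

/-! ### Book-keeping: residue classes and ranges -/

/-- `∑_{i < M} g(i+1) = ∑_{0 < n ≤ M} g(n)`. [folklore] -/
theorem sum_range_succ_eq_sum_Ioc (g : ℕ → ℂ) (M : ℕ) :
    ∑ i ∈ Finset.range M, g (i + 1) = ∑ n ∈ Finset.Ioc 0 M, g n := by
  induction M with
  | zero => simp
  | succ M ih => rw [Finset.sum_range_succ, Finset.sum_Ioc_succ_top (Nat.zero_le M), ih]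

/-- `∑_{0 < n ≤ M} g(n) = g(1) + ∑_{1 < n ≤ M} g(n)` for `M ≥ 1`. [folklore] -/
theorem sum_Ioc_zero_eq (g : ℕ → ℂ) {M : ℕ} (hM : 1 ≤ M) :
    ∑ n ∈ Finset.Ioc 0 M, g n = g 1 + ∑ n ∈ Finset.Ioc 1 M, g n := by
  rw [← Finset.sum_Ioc_consecutive g (Nat.zero_le 1) hM]
  simp

/-- **Residue classes**: `∑_{n < qM} g(n) = ∑_{m < M} ∑_{ℓ < q} g(mq + ℓ)`. [folklore] -/
theorem sum_range_mul_eq (g : ℕ → ℂ) (q M : ℕ) :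
    ∑ n ∈ Finset.range (q * M), g n =
      ∑ m ∈ Finset.range M, ∑ ℓ ∈ Finset.range q, g (m * q + ℓ) := by
  induction M with
  | zero => simp
  | succ M ih =>
    rw [Nat.mul_succ, Finset.sum_range_add, ih, Finset.sum_range_succ]
    congr 1
    refine Finset.sum_congr rfl fun ℓ _ ↦ ?_
    rw [mul_comm]

/-- `(mq + ℓ + 1)^{r} = q^{r} (m + (ℓ+1)/q)^{r}` (`q ≥ 1`). [folklore] -/
theorem natCast_mul_add_cpow {q : ℕ} (hq : 0 < q) (m ℓ : ℕ) (r : ℂ) :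
    ((m * q + ℓ + 1 : ℕ) : ℂ) ^ r = (q : ℂ) ^ r * (((m : ℝ) + ((ℓ : ℝ) + 1) / q : ℝ) : ℂ) ^ r := by
  have hq0 : (0 : ℝ) < q := by exact_mod_cast hq
  have hx : 0 ≤ (m : ℝ) + ((ℓ : ℝ) + 1) / q := by positivity
  have e : ((m * q + ℓ + 1 : ℕ) : ℂ) = ((q : ℝ) : ℂ) * (((m : ℝ) + ((ℓ : ℝ) + 1) / q : ℝ) : ℂ) := by
    have hq' : (q : ℂ) ≠ 0 := by exact_mod_cast hq.ne'
    push_cast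
    field_simp
    ring
  rw [e, Complex.mul_cpow_ofReal_nonneg hq0.le hx]
  push_cast
  ring

/-- Periodicity of `χ` in the residue-class indexing: `χ(mq + ℓ + 1) = χ(ℓ + 1)`. [folklore] -/
theorem chi_mul_add {q : ℕ} [NeZero q] (χ : DirichletCharacter ℂ q) (m ℓ : ℕ) :
    χ ((m * q + ℓ + 1 : ℕ) : ZMod q) = χ ((ℓ + 1 : ℕ) : ZMod q) := by
  congr 1
  push_cast
  simp

/-! ### The shifted zeta sums `∑ (n + u)^{-s}` in the main range -/

/-- Heights `t ≥ e^{300}`: `1 ≤ t`, `300 ≤ log t` and `404 log t ≤ t^{7/8}`. [folklore] -/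
theorem height_facts {t : ℝ} (ht : Real.exp 300 ≤ t) :
    1 ≤ t ∧ 300 ≤ Real.log t ∧ 404 * Real.log t * t ^ (-(7 / 8 : ℝ)) ≤ 1 := by
  have he : 1 ≤ Real.exp 300 := Real.one_le_exp (by norm_num)
  have ht1 : 1 ≤ t := he.trans ht
  have ht0 : 0 < t := by linarith
  have hL : 300 ≤ Real.log t := by
    rw [← Real.log_exp 300]; exact Real.log_le_log (Real.exp_pos _) ht
  refine ⟨ht1, hL, ?_⟩
  set L := Real.log t with hLdef
  have h78 : t ^ ((7 / 8 : ℝ)) = Real.exp (7 * L / 8) := by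
    rw [Real.rpow_def_of_pos ht0, ← hLdef]; ring_nf
  have hexp : (7 * L / 8) ^ 3 / (Nat.factorial 3) ≤ Real.exp (7 * L / 8) :=
    Real.pow_div_factorial_le_exp _ (by positivity) 3
  have h3 : (Nat.factorial 3 : ℝ) = 6 := by norm_num [Nat.factorial]
  rw [h3] at hexp
  have hL3 : (90000 : ℝ) * L ≤ L ^ 3 := by
    have h1 : (300 : ℝ) * 300 ≤ L * L := mul_le_mul hL hL (by norm_num) (by linarith)
    nlinarith
  have h5 : (7 * L / 8) ^ 3 / 6 = 343 / 3072 * L ^ 3 := by ring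
  have hbig : 404 * L ≤ Real.exp (7 * L / 8) := by linarith
  rw [Real.rpow_neg ht0.le, h78]
  rw [← div_eq_mul_inv, div_le_one (Real.exp_pos _)]
  exact hbig

/-- **The dyadic blocks of `∑_{1 < n ≤ U} (n + u)^{-s}`**, `U ≤ t²`, in the main range
`15/16 ≤ σ ≤ 1`, `t ≥ e^{300}`, `0 < u ≤ 1`: with `ExpSumBound C D`,
`‖∑_{1 < n ≤ U} (n + u)^{-s}‖ ≤ 4 C log t · t^{B_D(1−σ)^{3/2}} + 1`.  Blocks `(N, 2N]` with `N ≤ t` are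
`≤ N^{-σ} C N^{1 − (log N)²/(D log² t)} ≤ C t^{B_D(1−σ)^{3/2}}` (partial summation, the hypothesis,
`cubic_bound`); blocks with `N > t` are `≤ 101 N^{1−σ}/t ≤ 101 t^{-7/8}` (Kusmin–Landau,
`norm_shifted_sum_le_of_height_lt`); there are `≤ 4 log t` blocks and `404 log t ≤ t^{7/8}`.
[cite: Ford2002, Lemma 7.3 (proof) and Corollary 2A] -/
theorem norm_shifted_Ioc_le {C D : ℝ} (h : ExpSumBound C D) (hC : 0 ≤ C) (hD : 0 < D)
    {σ t u : ℝ} (hσ : 15 / 16 ≤ σ) (hσ1 : σ ≤ 1) (ht : Real.exp 300 ≤ t) (hu0 : 0 < u)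
    (hu1 : u ≤ 1) {U : ℕ} (hU : (U : ℝ) ≤ t ^ 2) :
    ‖∑ n ∈ Finset.Ioc 1 U, (((n : ℝ) + u : ℝ) : ℂ) ^ (-((σ : ℂ) + t * I))‖ ≤
      4 * C * Real.log t * t ^ (Bexp D * (1 - σ) ^ (3 / 2 : ℝ)) + 1 := by
  obtain ⟨ht1, hL300, hsmall⟩ := height_facts ht
  have ht0 : 0 < t := by linarith
  set L : ℝ := Real.log t with hLdef
  have hL0 : 0 < L := by linarith
  set m : ℝ := 1 - σ with hmdef
  have hm0 : 0 ≤ m := by rw [hmdef]; linarith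
  have hσ0 : 0 ≤ σ := by linarith
  set X : ℝ := t ^ (Bexp D * m ^ (3 / 2 : ℝ)) with hXdef
  have hX1 : 1 ≤ X := Real.one_le_rpow ht1 (mul_nonneg (Bexp_nonneg D) (Real.rpow_nonneg hm0 _))
  have hRHS0 : 0 ≤ 4 * C * L * X := by positivity
  rcases Nat.eq_zero_or_pos U with hU0 | hU1
  · subst hU0; simp; linarith
  -- the summand as weight × unimodular
  set a : ℕ → ℂ := fun n ↦ ((n : ℂ) + u) ^ (-(t * I)) with hadef
  set w : ℕ → ℝ := fun n ↦ ((n : ℝ) + u) ^ (-σ) with hwdef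
  have hga : ∀ n : ℕ, (((n : ℝ) + u : ℝ) : ℂ) ^ (-((σ : ℂ) + t * I)) = (w n : ℂ) * a n := by
    intro n
    have hx : 0 < (n : ℝ) + u := by positivity
    rw [ofReal_cpow_neg_add hx, hwdef, hadef]
    push_cast; rfl
  -- block bound function
  set G : ℕ → ℝ := fun N ↦ if (N : ℝ) ≤ t
    then (N : ℝ) ^ (-σ) * (C * (N : ℝ) ^ (1 - Real.log N ^ 2 / (D * L ^ 2)))
    else (N : ℝ) ^ (-σ) * (101 * N / t) with hGdef
  have hG0 : ∀ N, 0 ≤ G N := fun N ↦ by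
    rw [hGdef]; simp only; split_ifs <;> positivity
  -- block estimate
  have hblock : ∀ i : ℕ, 1 * 2 ^ i < U →
      ‖∑ n ∈ Finset.Ioc (1 * 2 ^ i) (min (1 * 2 ^ (i + 1)) U),
        (((n : ℝ) + u : ℝ) : ℂ) ^ (-((σ : ℂ) + t * I))‖ ≤ G (1 * 2 ^ i) := by
    intro i hi
    rw [one_mul] at hi ⊢
    rw [one_mul]
    set N : ℕ := 2 ^ i with hNdef
    have hN1 : 1 ≤ N := Nat.one_le_two_pow
    have hN0 : (0 : ℝ) < N := by exact_mod_cast hN1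
    set x : ℕ := min (2 ^ (i + 1)) U with hxdef
    have hNx : N ≤ x := le_min (Nat.pow_le_pow_right (by norm_num) (by omega)) hi.le
    have hx2 : x ≤ 2 * N := (min_le_left _ _).trans (le_of_eq (by rw [hNdef]; ring))
    obtain ⟨mm, hmm⟩ : ∃ mm, x = N + mm := ⟨x - N, by omega⟩
    -- the bound on partial exponential sums over `(N, y]`, `y ≤ 2N`
    set Bnd : ℝ := if (N : ℝ) ≤ t then C * (N : ℝ) ^ (1 - Real.log N ^ 2 / (D * L ^ 2))
      else 101 * N / t with hBnddef
    have hBnd0 : 0 ≤ Bnd := by rw [hBnddef]; split_ifs <;> positivity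
    have hpart : ∀ y, N < y → y ≤ N + mm → ‖∑ n ∈ Finset.Ioc N y, a n‖ ≤ Bnd := by
      intro y hy1 hy2
      have hy2N : y ≤ 2 * N := by omega
      rw [hBnddef]
      split_ifs with hNt
      · exact h N y t u hN1 hNt hu0 hu1 hy1 hy2N
      · exact norm_shifted_sum_le_of_height_lt hu0 hu1 ht1 (not_le.1 hNt) hy2N
    have hanti : ∀ n₁ n₂ : ℕ, N < n₁ → n₁ ≤ n₂ → n₂ ≤ N + mm → w n₂ ≤ w n₁ := by
      intro n₁ n₂ _ h12 _
      have h12' : (n₁ : ℝ) ≤ n₂ := by exact_mod_cast h12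
      exact Real.rpow_le_rpow_of_nonpos (by positivity) (by linarith) (by linarith)
    have habel := VdC.abel_bound a N hBnd0 mm w hanti (fun n _ _ ↦ by positivity)
      (by positivity) hpart
    rw [hmm]
    rw [Finset.sum_congr rfl fun n _ ↦ hga n]
    refine habel.trans ?_
    -- `w(N+1) · Bnd ≤ N^{-σ} · Bnd = G N`
    have hwN : w (N + 1) ≤ (N : ℝ) ^ (-σ) :=
      Real.rpow_le_rpow_of_nonpos hN0 (by push_cast; linarith) (by linarith)
    have hG : G N = (N : ℝ) ^ (-σ) * Bnd := by
      rw [hGdef, hBnddef]; simp only; split_ifs <;> rfl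
    rw [hG]
    exact mul_le_mul_of_nonneg_right hwN hBnd0
  -- dyadic decomposition
  set J : ℕ := Nat.log 2 U with hJ
  have h2J : U ≤ 1 * 2 ^ (J + 1) := by
    rw [one_mul]; exact (Nat.lt_pow_succ_log_self one_lt_two U).le
  have hdy := VdC.dyadic_bound (fun n : ℕ ↦ (((n : ℝ) + u : ℝ) : ℂ) ^ (-((σ : ℂ) + t * I))) G hG0 U
    (J + 1) 1 hblock h2J
  -- each `G(2^i)`, `i ≤ J`, is `≤ C X + 101 t^{-7/8}`
  have hexpB : Real.exp (Bexp D * m ^ (3 / 2 : ℝ) * L) = X := by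
    rw [hXdef, Real.rpow_def_of_pos ht0, ← hLdef]; ring_nf
  have hGle : ∀ i ∈ Finset.range (J + 1), G (1 * 2 ^ i) ≤ C * X + 101 * t ^ (-(7 / 8 : ℝ)) := by
    intro i hi
    have hiJ : i ≤ J := Nat.lt_succ_iff.1 (Finset.mem_range.1 hi)
    have h2iU : 2 ^ i ≤ U := le_trans (Nat.pow_le_pow_right (by norm_num) hiJ)
      (hJ ▸ Nat.pow_log_le_self 2 (by omega))
    have h2iU' : ((2 : ℝ) ^ i) ≤ t ^ 2 := le_trans (by exact_mod_cast h2iU) hU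
    have hpos1 : 0 ≤ C * X := by positivity
    have hpos2 : 0 ≤ 101 * t ^ (-(7 / 8 : ℝ)) := by positivity
    rw [hGdef, one_mul]
    simp only [Nat.cast_pow, Nat.cast_ofNat]
    split_ifs with hle
    · -- Ford range
      refine le_trans ?_ (le_add_of_nonneg_right hpos2)
      rw [mul_left_comm, dyadic_term_eq]
      refine mul_le_mul_of_nonneg_left ?_ hC
      rw [← hexpB, Real.exp_le_exp, ← hmdef]
      exact cubic_bound hm0 (by positivity) hD hL0
    · -- Kusmin–Landau range: `(2^i)^{-σ} · 101 · 2^i/t = 101 (2^i)^{1-σ}/t ≤ 101 t^{2(1-σ)-1}`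
      refine le_trans ?_ (le_add_of_nonneg_left hpos1)
      have h2i0 : (0 : ℝ) < (2 : ℝ) ^ i := by positivity
      have e1 : ((2 : ℝ) ^ i) ^ (-σ) * (101 * (2 : ℝ) ^ i / t) = 101 * ((2 : ℝ) ^ i) ^ (1 - σ) / t := by
        rw [Real.rpow_sub h2i0, Real.rpow_one, Real.rpow_neg h2i0.le]; field_simp
      rw [e1, div_le_iff₀ ht0]
      have h3 : ((2 : ℝ) ^ i) ^ (1 - σ) ≤ (t ^ (2 : ℕ)) ^ (1 - σ) :=
        Real.rpow_le_rpow h2i0.le h2iU' (by linarith)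
      have h4 : (t ^ (2 : ℕ)) ^ (1 - σ) ≤ t ^ (-(7 / 8 : ℝ)) * t := by
        rw [← Real.rpow_natCast t 2, ← Real.rpow_mul ht0.le, ← Real.rpow_add_one ht0.ne']
        exact Real.rpow_le_rpow_of_exponent_le ht1 (by push_cast; linarith)
      nlinarith
  have hJL : (J : ℝ) + 1 ≤ 4 * L := by
    have := log_two_nat_add_one_le (t := t ^ 2) hU1 hU (by rw [Real.log_pow]; push_cast; linarith)
    rw [Real.log_pow] at this; push_cast at this; linarith
  calc ‖∑ n ∈ Finset.Ioc 1 U, (((n : ℝ) + u : ℝ) : ℂ) ^ (-((σ : ℂ) + t * I))‖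
      ≤ ∑ i ∈ Finset.range (J + 1), G (1 * 2 ^ i) := hdy
    _ ≤ ∑ _i ∈ Finset.range (J + 1), (C * X + 101 * t ^ (-(7 / 8 : ℝ))) := Finset.sum_le_sum hGle
    _ = ((J : ℝ) + 1) * (C * X + 101 * t ^ (-(7 / 8 : ℝ))) := by
        rw [Finset.sum_const, Finset.card_range, nsmul_eq_mul]; push_cast; ring
    _ ≤ (4 * L) * (C * X + 101 * t ^ (-(7 / 8 : ℝ))) :=
        mul_le_mul_of_nonneg_right hJL (by positivity)
    _ = 4 * C * L * X + 404 * L * t ^ (-(7 / 8 : ℝ)) := by ring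
    _ ≤ 4 * C * L * X + 1 := by linarith

/-- **The full shifted sum `∑_{0 ≤ m < M} (m + u)^{-s}`**, `M ≤ t² + 1`, in the main range:
`≤ u^{-σ} + 2 + 4 C log t · t^{B_D(1−σ)^{3/2}}` (the terms `m = 0, 1` and `norm_shifted_Ioc_le`).
[cite: Ford2002, Lemma 7.3 (proof)] -/
theorem norm_range_shifted_le {C D : ℝ} (h : ExpSumBound C D) (hC : 0 ≤ C) (hD : 0 < D)
    {σ t u : ℝ} (hσ : 15 / 16 ≤ σ) (hσ1 : σ ≤ 1) (ht : Real.exp 300 ≤ t) (hu0 : 0 < u)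
    (hu1 : u ≤ 1) {M : ℕ} (hM : (M : ℝ) ≤ t ^ 2 + 1) :
    ‖∑ mm ∈ Finset.range M, (((mm : ℝ) + u : ℝ) : ℂ) ^ (-((σ : ℂ) + t * I))‖ ≤
      u ^ (-σ) + 2 + 4 * C * Real.log t * t ^ (Bexp D * (1 - σ) ^ (3 / 2 : ℝ)) := by
  obtain ⟨ht1, hL300, -⟩ := height_facts ht
  have ht0 : 0 < t := by linarith
  have hL0 : 0 ≤ Real.log t := by linarith
  have hX0 : 0 ≤ t ^ (Bexp D * (1 - σ) ^ (3 / 2 : ℝ)) := by positivity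
  have hbig : 0 ≤ 4 * C * Real.log t * t ^ (Bexp D * (1 - σ) ^ (3 / 2 : ℝ)) := by positivity
  have hu : 0 ≤ u ^ (-σ) := by positivity
  rcases Nat.eq_zero_or_pos M with hM0 | hMpos
  · subst hM0; simp; linarith
  obtain ⟨M', rfl⟩ : ∃ M', M = M' + 1 := ⟨M - 1, by omega⟩
  rw [Finset.sum_range_succ']
  -- the term `m = 0`
  have h0 : ‖((((0 : ℕ) : ℝ) + u : ℝ) : ℂ) ^ (-((σ : ℂ) + t * I))‖ = u ^ (-σ) := by
    rw [Nat.cast_zero, zero_add, Complex.norm_cpow_eq_rpow_re_of_pos hu0]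
    simp
  -- the terms `m ≥ 1`
  have hrest : ‖∑ i ∈ Finset.range M', ((((i + 1 : ℕ) : ℝ) + u : ℝ) : ℂ) ^ (-((σ : ℂ) + t * I))‖ ≤
      2 + 4 * C * Real.log t * t ^ (Bexp D * (1 - σ) ^ (3 / 2 : ℝ)) := by
    rw [sum_range_succ_eq_sum_Ioc (fun n ↦ (((n : ℝ) + u : ℝ) : ℂ) ^ (-((σ : ℂ) + t * I))) M']
    rcases Nat.eq_zero_or_pos M' with hM'0 | hM'pos
    · subst hM'0; simp; linarith
    rw [sum_Ioc_zero_eq _ hM'pos]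
    have h1 : ‖((((1 : ℕ) : ℝ) + u : ℝ) : ℂ) ^ (-((σ : ℂ) + t * I))‖ ≤ 1 := by
      rw [Complex.norm_cpow_eq_rpow_re_of_pos (by positivity)]
      simp only [Complex.neg_re, Complex.add_re, Complex.ofReal_re, Complex.mul_re, Complex.I_re,
        Complex.ofReal_im, Complex.I_im, mul_zero, mul_one, sub_self, add_zero, Nat.cast_one]
      exact Real.rpow_le_one_of_one_le_of_nonpos (by linarith) (by linarith)
    have hM' : (M' : ℝ) ≤ t ^ 2 := by push_cast at hM; linarith
    have h2 := norm_shifted_Ioc_le h hC hD hσ hσ1 ht hu0 hu1 hM'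
    calc _ ≤ ‖((((1 : ℕ) : ℝ) + u : ℝ) : ℂ) ^ (-((σ : ℂ) + t * I))‖ +
          ‖∑ n ∈ Finset.Ioc 1 M', (((n : ℝ) + u : ℝ) : ℂ) ^ (-((σ : ℂ) + t * I))‖ := norm_add_le _ _
      _ ≤ 1 + (4 * C * Real.log t * t ^ (Bexp D * (1 - σ) ^ (3 / 2 : ℝ)) + 1) := add_le_add h1 h2
      _ = _ := by ring
  calc _ ≤ ‖∑ i ∈ Finset.range M', ((((i + 1 : ℕ) : ℝ) + u : ℝ) : ℂ) ^ (-((σ : ℂ) + t * I))‖ +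
        ‖((((0 : ℕ) : ℝ) + u : ℝ) : ℂ) ^ (-((σ : ℂ) + t * I))‖ := norm_add_le _ _
    _ ≤ (2 + 4 * C * Real.log t * t ^ (Bexp D * (1 - σ) ^ (3 / 2 : ℝ))) + u ^ (-σ) := by
        rw [h0]; linarith [hrest]
    _ = _ := by ring

/-! ### Assembly for `L(s, χ)` in the main range -/

/-- The `m = 0` terms: `q^{-σ} ((ℓ+1)/q)^{-σ} = (ℓ+1)^{-σ} ≤ q^{1−σ}/(ℓ+1)` for `ℓ + 1 ≤ q`,
`σ ≤ 1`. [folklore] -/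
theorem residue_term_le {q : ℕ} {ℓ : ℕ} (hℓ : ℓ + 1 ≤ q) {σ : ℝ} (hσ1 : σ ≤ 1) :
    (q : ℝ) ^ (-σ) * (((ℓ : ℝ) + 1) / q) ^ (-σ) ≤ (q : ℝ) ^ (1 - σ) / ((ℓ : ℝ) + 1) := by
  have hq0 : (0 : ℝ) < q := by exact_mod_cast (show 0 < q by omega)
  have hℓ0 : (0 : ℝ) < (ℓ : ℝ) + 1 := by positivity
  have hℓq : (ℓ : ℝ) + 1 ≤ q := by exact_mod_cast hℓ
  rw [← Real.mul_rpow hq0.le (by positivity), mul_div_cancel₀ _ hq0.ne']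
  have e : ((ℓ : ℝ) + 1) ^ (-σ) = ((ℓ : ℝ) + 1) ^ (1 - σ) * ((ℓ : ℝ) + 1)⁻¹ := by
    rw [← Real.rpow_neg_one, ← Real.rpow_add hℓ0]; ring_nf
  rw [e, div_eq_mul_inv]
  exact mul_le_mul_of_nonneg_right (Real.rpow_le_rpow hℓ0.le hℓq (by linarith)) (by positivity)

/-- The tail coefficient: for `q ≥ 1`, `M ≥ t²/4`, `1/2 ≤ σ ≤ 1`, `t ≥ 1` and `S ≤ 2t`,
`q (qM)^{-σ} (1 + S/σ) ≤ 20 q^{1−σ}` (`M^{-σ} ≤ 4 t^{-2σ}`, `1 + S/σ ≤ 5t`, `t^{1−2σ} ≤ 1`).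
[folklore] -/
theorem tail_coeff_le {q : ℕ} (hq : 1 ≤ q) {M t σ S : ℝ} (ht : 1 ≤ t) (hM : t ^ 2 / 4 ≤ M)
    (hσ : 1 / 2 ≤ σ) (hσ1 : σ ≤ 1) (hS0 : 0 ≤ S) (hS : S ≤ 2 * t) :
    (q : ℝ) * ((q : ℝ) * M) ^ (-σ) * (1 + S / σ) ≤ 20 * (q : ℝ) ^ (1 - σ) := by
  have hq0 : (0 : ℝ) < q := by exact_mod_cast hq
  have ht0 : 0 < t := by linarith
  have hM0 : 0 < M := lt_of_lt_of_le (by positivity) hM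
  have hσ0 : 0 < σ := by linarith
  -- `M^{-σ} ≤ (t²/4)^{-σ} = 4^σ t^{-2σ} ≤ 4 t^{-2σ}` and `t · t^{-2σ} = t^{1-2σ} ≤ 1`
  have h1 : M ^ (-σ) ≤ (t ^ 2 / 4) ^ (-σ) := Real.rpow_le_rpow_of_nonpos (by positivity) hM (by linarith)
  have h2 : (t ^ 2 / 4) ^ (-σ) * t ≤ 4 := by
    rw [Real.div_rpow (by positivity) (by norm_num), Real.rpow_neg (by norm_num : (0:ℝ) ≤ 4),
      ← Real.rpow_natCast t 2, ← Real.rpow_mul ht0.le]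
    have h4 : ((4 : ℝ) ^ σ)⁻¹ * 4 ^ σ = 1 := inv_mul_cancel₀ (by positivity)
    have h4σ : (4 : ℝ) ^ σ ≤ 4 := by
      calc (4 : ℝ) ^ σ ≤ 4 ^ (1 : ℝ) := Real.rpow_le_rpow_of_exponent_le (by norm_num) hσ1
        _ = 4 := Real.rpow_one 4
    have h5 : t ^ ((2 : ℕ) * -σ : ℝ) * t = t ^ (1 - 2 * σ) := by
      rw [← Real.rpow_add_one ht0.ne']; push_cast; ring_nf
    have h6 : t ^ (1 - 2 * σ) ≤ 1 := Real.rpow_le_one_of_one_le_of_nonpos ht (by linarith)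
    have h40 : 0 < (4 : ℝ) ^ σ := by positivity
    calc t ^ ((2 : ℕ) * -σ : ℝ) / ((4 : ℝ) ^ σ)⁻¹ * t = 4 ^ σ * (t ^ ((2 : ℕ) * -σ : ℝ) * t) := by
          field_simp
      _ = 4 ^ σ * t ^ (1 - 2 * σ) := by rw [h5]
      _ ≤ 4 * 1 := mul_le_mul h4σ h6 (by positivity) (by norm_num)
      _ = 4 := by ring
  have h3 : 1 + S / σ ≤ 5 * t := by
    have : S / σ ≤ 2 * S := by
      rw [div_le_iff₀ hσ0]; nlinarith
    linarith
  have hqq : (q : ℝ) * (q : ℝ) ^ (-σ) = (q : ℝ) ^ (1 - σ) := by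
    rw [Real.rpow_sub hq0, Real.rpow_one, Real.rpow_neg hq0.le, div_eq_mul_inv]
  rw [Real.mul_rpow hq0.le hM0.le]
  calc (q : ℝ) * ((q : ℝ) ^ (-σ) * M ^ (-σ)) * (1 + S / σ)
      = (q : ℝ) ^ (1 - σ) * (M ^ (-σ) * (1 + S / σ)) := by rw [← hqq]; ring
    _ ≤ (q : ℝ) ^ (1 - σ) * ((t ^ 2 / 4) ^ (-σ) * (5 * t)) := by
        refine mul_le_mul_of_nonneg_left ?_ (by positivity)
        exact mul_le_mul h1 h3 (by positivity) (by positivity)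
    _ = (q : ℝ) ^ (1 - σ) * (5 * ((t ^ 2 / 4) ^ (-σ) * t)) := by ring
    _ ≤ (q : ℝ) ^ (1 - σ) * (5 * 4) := by gcongr
    _ = 20 * (q : ℝ) ^ (1 - σ) := by ring

/-- **`L(s, χ)` in the main range** (`χ ≠ χ₀` mod `q`, `15/16 ≤ σ ≤ 1`, `t ≥ e^{300}`): with
`ExpSumBound C D`,
`|L(σ + it, χ)| ≤ (23 + 4C) q^{1−σ}(1 + log q) t^{B_D(1−σ)^{3/2}} log t`.
Decomposition: `L = ∑_{n ≤ qM} χ(n)n^{-s} + O(20 q^{1−σ})` (`M = ⌊t⌋²`, one Abel summation),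
`∑_{n ≤ qM} χ(n) n^{-s} = q^{-s} ∑_{ℓ ≤ q} χ(ℓ) ∑_{0 ≤ m < M} (m + ℓ/q)^{-s}` (residue classes, as in
Ford's Corollary 2A), each inner sum `≤ (ℓ/q)^{-σ} + 2 + 4C log t · t^{B_D(1−σ)^{3/2}}`
(`norm_range_shifted_le`), and `∑_{ℓ ≤ q} ℓ^{-σ} ≤ q^{1−σ}(1 + log q)`.
[cite: Ford2002, Lemma 7.3 and Corollary 2A] -/
theorem norm_LFunction_le_main {C D : ℝ} (h : ExpSumBound C D) (hC : 0 ≤ C) (hD : 0 < D)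
    {q : ℕ} [NeZero q] (χ : DirichletCharacter ℂ q) (hχ : χ ≠ 1) {σ t : ℝ} (hσ : 15 / 16 ≤ σ)
    (hσ1 : σ ≤ 1) (ht : Real.exp 300 ≤ t) :
    ‖χ.LFunction (σ + t * I)‖ ≤ (23 + 4 * C) * (q : ℝ) ^ (1 - σ) * (1 + Real.log q) *
      t ^ (Bexp D * (1 - σ) ^ (3 / 2 : ℝ)) * Real.log t := by
  obtain ⟨ht1, hL300, -⟩ := height_facts ht
  have ht0 : 0 < t := by linarith
  set L : ℝ := Real.log t with hLdef
  have hL1 : 1 ≤ L := by linarith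
  set X : ℝ := t ^ (Bexp D * (1 - σ) ^ (3 / 2 : ℝ)) with hXdef
  have hX1 : 1 ≤ X :=
    Real.one_le_rpow ht1 (mul_nonneg (Bexp_nonneg D) (Real.rpow_nonneg (by linarith) _))
  have hq1 : 1 ≤ q := NeZero.one_le
  have hq0 : (0 : ℝ) < q := by exact_mod_cast NeZero.pos q
  have hlogq : 0 ≤ Real.log q := Real.log_natCast_nonneg q
  have hQ0 : 0 ≤ (q : ℝ) ^ (1 - σ) := by positivity
  set s : ℂ := (σ : ℂ) + t * I with hsdef
  have hsre : s.re = σ := by simp [hsdef]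
  have hs0 : 0 < s.re := by rw [hsre]; linarith
  have hsnorm : ‖s‖ ≤ 2 * t := by
    have h1 := Complex.norm_le_abs_re_add_abs_im s
    have h2 : |s.re| ≤ 1 := by rw [hsre, abs_le]; constructor <;> linarith
    have h3 : |s.im| = t := by simp [hsdef, abs_of_pos ht0]
    linarith
  -- the length `N = q M`, `M = ⌊t⌋²`
  set t' : ℕ := ⌊t⌋₊ with ht'def
  have ht'1 : 1 ≤ t' := Nat.le_floor (by simpa using ht1)
  have ht't : (t' : ℝ) ≤ t := Nat.floor_le ht0.le
  have ht2 : 2 ≤ t := le_trans (by have := Real.add_one_le_exp (300 : ℝ); linarith) ht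
  have ht'ge : t / 2 ≤ t' := by
    have := Nat.lt_floor_add_one t
    rw [← ht'def] at this
    linarith
  set M : ℕ := t' ^ 2 with hMdef
  have hM1 : 1 ≤ M := Nat.one_le_pow _ _ ht'1
  have hMt2 : (M : ℝ) ≤ t ^ 2 := by
    rw [hMdef]; push_cast; gcongr
  have hMge : t ^ 2 / 4 ≤ M := by rw [hMdef]; push_cast; nlinarith
  set N : ℕ := q * M with hNdef
  have hN1 : 1 ≤ N := Nat.one_le_iff_ne_zero.2 (Nat.mul_ne_zero (NeZero.ne q) (by omega))
  -- Step 1: the tail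
  have htail := norm_LFunction_sub_sum_range_le χ hχ hs0 hN1
  rw [hsre] at htail
  have htail' : (q : ℝ) * (N : ℝ) ^ (-σ) * (1 + ‖s‖ / σ) ≤ 20 * (q : ℝ) ^ (1 - σ) := by
    have hN : (N : ℝ) = q * M := by rw [hNdef]; push_cast; ring
    rw [hN]
    exact tail_coeff_le hq1 ht1 hMge (by linarith) hσ1 (norm_nonneg s) hsnorm
  -- Step 2: residue classes
  have hH : ∑ n ∈ Finset.range N, χ ((n + 1 : ℕ) : ZMod q) * ((n + 1 : ℕ) : ℂ) ^ (-s) =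
      ∑ ℓ ∈ Finset.range q, χ ((ℓ + 1 : ℕ) : ZMod q) * (q : ℂ) ^ (-s) *
        ∑ mm ∈ Finset.range M, (((mm : ℝ) + ((ℓ : ℝ) + 1) / q : ℝ) : ℂ) ^ (-s) := by
    rw [hNdef, sum_range_mul_eq, Finset.sum_comm]
    refine Finset.sum_congr rfl fun ℓ _ ↦ ?_
    rw [Finset.mul_sum]
    refine Finset.sum_congr rfl fun mm _ ↦ ?_
    rw [chi_mul_add, natCast_mul_add_cpow (NeZero.pos q)]
    ring
  -- Step 3: the inner sums
  have hinner : ∀ ℓ ∈ Finset.range q,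
      ‖χ ((ℓ + 1 : ℕ) : ZMod q) * (q : ℂ) ^ (-s) *
        ∑ mm ∈ Finset.range M, (((mm : ℝ) + ((ℓ : ℝ) + 1) / q : ℝ) : ℂ) ^ (-s)‖ ≤
        (q : ℝ) ^ (1 - σ) / ((ℓ : ℝ) + 1) + (q : ℝ) ^ (-σ) * (2 + 4 * C * L * X) := by
    intro ℓ hℓ
    have hℓq : ℓ + 1 ≤ q := Finset.mem_range.1 hℓ
    have hu0 : 0 < ((ℓ : ℝ) + 1) / q := by positivity
    have hu1 : ((ℓ : ℝ) + 1) / q ≤ 1 := by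
      rw [div_le_one hq0]; exact_mod_cast hℓq
    have hin := norm_range_shifted_le h hC hD hσ hσ1 ht hu0 hu1 (M := M) (by linarith)
    rw [norm_mul, norm_mul, Complex.norm_natCast_cpow_of_pos (NeZero.pos q)]
    simp only [Complex.neg_re, hsre]
    have hχ1 : ‖χ ((ℓ + 1 : ℕ) : ZMod q)‖ ≤ 1 := χ.norm_le_one _
    have hqσ : 0 ≤ (q : ℝ) ^ (-σ) := by positivity
    calc ‖χ ((ℓ + 1 : ℕ) : ZMod q)‖ * (q : ℝ) ^ (-σ) *
          ‖∑ mm ∈ Finset.range M, (((mm : ℝ) + ((ℓ : ℝ) + 1) / q : ℝ) : ℂ) ^ (-s)‖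
        ≤ 1 * (q : ℝ) ^ (-σ) * ((((ℓ : ℝ) + 1) / q) ^ (-σ) + 2 + 4 * C * L * X) := by
          refine mul_le_mul (mul_le_mul_of_nonneg_right hχ1 hqσ) hin (norm_nonneg _) (by positivity)
      _ = (q : ℝ) ^ (-σ) * (((ℓ : ℝ) + 1) / q) ^ (-σ) + (q : ℝ) ^ (-σ) * (2 + 4 * C * L * X) := by ring
      _ ≤ _ := add_le_add (residue_term_le hℓq hσ1) le_rfl
  have hHnorm : ‖∑ n ∈ Finset.range N, χ ((n + 1 : ℕ) : ZMod q) * ((n + 1 : ℕ) : ℂ) ^ (-s)‖ ≤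
      (q : ℝ) ^ (1 - σ) * (1 + Real.log q) + (q : ℝ) ^ (1 - σ) * (2 + 4 * C * L * X) := by
    rw [hH]
    refine (norm_sum_le _ _).trans ((Finset.sum_le_sum hinner).trans ?_)
    rw [Finset.sum_add_distrib, Finset.sum_const, Finset.card_range, nsmul_eq_mul]
    have h1 : ∑ ℓ ∈ Finset.range q, (q : ℝ) ^ (1 - σ) / ((ℓ : ℝ) + 1) ≤
        (q : ℝ) ^ (1 - σ) * (1 + Real.log q) := by
      have := VKFromRichert.sum_range_one_div_succ_le q
      simp_rw [div_eq_mul_one_div ((q : ℝ) ^ (1 - σ))]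
      rw [← Finset.mul_sum]
      refine mul_le_mul_of_nonneg_left (le_trans (le_of_eq ?_) this) hQ0
      refine Finset.sum_congr rfl fun ℓ _ ↦ ?_
      push_cast; ring
    have h2 : (q : ℝ) * ((q : ℝ) ^ (-σ) * (2 + 4 * C * L * X)) =
        (q : ℝ) ^ (1 - σ) * (2 + 4 * C * L * X) := by
      rw [← mul_assoc, Real.rpow_sub hq0, Real.rpow_one, Real.rpow_neg hq0.le, div_eq_mul_inv]
    linarith
  -- Step 4: combine
  have hL : ‖χ.LFunction s‖ ≤
      ‖χ.LFunction s - ∑ n ∈ Finset.range N, χ ((n + 1 : ℕ) : ZMod q) * ((n + 1 : ℕ) : ℂ) ^ (-s)‖ +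
        ‖∑ n ∈ Finset.range N, χ ((n + 1 : ℕ) : ZMod q) * ((n + 1 : ℕ) : ℂ) ^ (-s)‖ :=
    norm_le_norm_sub_add _ _
  have hmain : ‖χ.LFunction s‖ ≤ (q : ℝ) ^ (1 - σ) * (23 + Real.log q + 4 * C * L * X) := by
    nlinarith
  refine hmain.trans ?_
  -- `23 + log q + 4CLX ≤ (23 + 4C)(1 + log q) X L`
  have hXL : 1 ≤ X * L := by nlinarith
  have hkey : 23 + Real.log q + 4 * C * L * X ≤ (23 + 4 * C) * (1 + Real.log q) * X * L := by
    have e : (23 + 4 * C) * (1 + Real.log q) * X * L =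
        23 * (1 + Real.log q) * (X * L) + 4 * C * (X * L) + 4 * C * Real.log q * (X * L) := by ring
    rw [e]
    have h1 : 23 + Real.log q ≤ 23 * (1 + Real.log q) * (X * L) := by
      have : 23 + Real.log q ≤ 23 * (1 + Real.log q) := by linarith
      exact this.trans (le_mul_of_one_le_right (by positivity) hXL)
    have h2 : 0 ≤ 4 * C * Real.log q * (X * L) := by positivity
    nlinarith
  calc (q : ℝ) ^ (1 - σ) * (23 + Real.log q + 4 * C * L * X)
      ≤ (q : ℝ) ^ (1 - σ) * ((23 + 4 * C) * (1 + Real.log q) * X * L) :=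
        mul_le_mul_of_nonneg_left hkey hQ0
    _ = _ := by ring

/-! ### The crude ranges `σ ≤ 15/16` or `t ≤ e^{300}` for `L(s, χ)` -/

/-- **Crude bound** (any `1/2 ≤ σ ≤ 1`, `t ≥ 3`, `χ ≠ χ₀` mod `q`):
`|L(σ + it, χ)| ≤ 12 q^{1−σ}(1 + log q) log t · t^{1−σ}` — one Abel summation at `N = q⌊t⌋`
(tail `≤ 10 q^{1−σ}t^{1−σ}`) and `|∑_{n ≤ N} χ(n)n^{-s}| ≤ N^{1−σ} ∑_{n ≤ N} 1/n ≤ (qt)^{1−σ}(1 + log qt)`.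
[cite: MontgomeryVaughan2007, §1.3 Thm. 1.3 and §4.3 (4.23)] -/
theorem norm_LFunction_le_crude {q : ℕ} [NeZero q] (χ : DirichletCharacter ℂ q) (hχ : χ ≠ 1)
    {σ t : ℝ} (hσ : 1 / 2 ≤ σ) (hσ1 : σ ≤ 1) (ht : 3 ≤ t) :
    ‖χ.LFunction (σ + t * I)‖ ≤
      12 * (q : ℝ) ^ (1 - σ) * (1 + Real.log q) * Real.log t * t ^ (1 - σ) := by
  have ht0 : 0 < t := by linarith
  have ht1 : 1 ≤ t := by linarith
  set L : ℝ := Real.log t with hLdef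
  have hL1 : 1 ≤ L := by
    rw [hLdef, ← Real.log_exp 1]
    exact Real.log_le_log (Real.exp_pos 1) (by have := Real.exp_one_lt_d9; linarith)
  have hq1 : 1 ≤ q := NeZero.one_le
  have hq0 : (0 : ℝ) < q := by exact_mod_cast NeZero.pos q
  have hlogq : 0 ≤ Real.log q := Real.log_natCast_nonneg q
  have hQ0 : 0 ≤ (q : ℝ) ^ (1 - σ) := by positivity
  have hT0 : 0 ≤ t ^ (1 - σ) := by positivity
  set s : ℂ := (σ : ℂ) + t * I with hsdef
  have hsre : s.re = σ := by simp [hsdef]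
  have hs0 : 0 < s.re := by rw [hsre]; linarith
  have hsnorm : ‖s‖ ≤ 2 * t := by
    have h1 := Complex.norm_le_abs_re_add_abs_im s
    have h2 : |s.re| ≤ 1 := by rw [hsre, abs_le]; constructor <;> linarith
    have h3 : |s.im| = t := by simp [hsdef, abs_of_pos ht0]
    linarith
  set t' : ℕ := ⌊t⌋₊ with ht'def
  have ht'1 : 1 ≤ t' := Nat.le_floor (by simpa using ht1)
  have ht't : (t' : ℝ) ≤ t := Nat.floor_le ht0.le
  have ht'ge : t / 2 ≤ t' := by
    have := Nat.lt_floor_add_one t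
    rw [← ht'def] at this
    linarith
  have ht'0 : (0 : ℝ) < t' := by linarith
  set N : ℕ := q * t' with hNdef
  have hN1 : 1 ≤ N := Nat.one_le_iff_ne_zero.2 (Nat.mul_ne_zero (NeZero.ne q) (by omega))
  have hNr : (N : ℝ) = q * t' := by rw [hNdef]; push_cast; ring
  have hN0 : (0 : ℝ) < N := by rw [hNr]; positivity
  have hNqt : (N : ℝ) ≤ q * t := by rw [hNr]; gcongr
  -- tail
  have htail := norm_LFunction_sub_sum_range_le χ hχ hs0 hN1
  rw [hsre] at htail
  have hqq : (q : ℝ) * (q : ℝ) ^ (-σ) = (q : ℝ) ^ (1 - σ) := by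
    rw [Real.rpow_sub hq0, Real.rpow_one, Real.rpow_neg hq0.le, div_eq_mul_inv]
  have htail' : (q : ℝ) * (N : ℝ) ^ (-σ) * (1 + ‖s‖ / σ) ≤ 10 * (q : ℝ) ^ (1 - σ) * t ^ (1 - σ) := by
    rw [hNr, Real.mul_rpow hq0.le ht'0.le]
    have h1 : (t' : ℝ) ^ (-σ) ≤ (t / 2) ^ (-σ) :=
      Real.rpow_le_rpow_of_nonpos (by positivity) ht'ge (by linarith)
    have h2 : (t / 2) ^ (-σ) * t ≤ 2 * t ^ (1 - σ) := by
      rw [Real.div_rpow ht0.le (by norm_num), Real.rpow_neg (by norm_num : (0:ℝ) ≤ 2)]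
      have h2σ : (2 : ℝ) ^ σ ≤ 2 := by
        calc (2 : ℝ) ^ σ ≤ 2 ^ (1 : ℝ) := Real.rpow_le_rpow_of_exponent_le (by norm_num) hσ1
          _ = 2 := Real.rpow_one 2
      have h5 : t ^ (-σ) * t = t ^ (1 - σ) := by
        rw [← Real.rpow_add_one ht0.ne']; ring_nf
      have h20 : 0 < (2 : ℝ) ^ σ := by positivity
      calc t ^ (-σ) / ((2 : ℝ) ^ σ)⁻¹ * t = 2 ^ σ * (t ^ (-σ) * t) := by field_simp
        _ = 2 ^ σ * t ^ (1 - σ) := by rw [h5]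
        _ ≤ 2 * t ^ (1 - σ) := mul_le_mul_of_nonneg_right h2σ hT0
    have h3 : 1 + ‖s‖ / σ ≤ 5 * t := by
      have hσ0 : 0 < σ := by linarith
      have : ‖s‖ / σ ≤ 2 * ‖s‖ := by
        rw [div_le_iff₀ hσ0]; nlinarith [norm_nonneg s]
      linarith [norm_nonneg s]
    calc (q : ℝ) * ((q : ℝ) ^ (-σ) * (t' : ℝ) ^ (-σ)) * (1 + ‖s‖ / σ)
        = (q : ℝ) ^ (1 - σ) * ((t' : ℝ) ^ (-σ) * (1 + ‖s‖ / σ)) := by rw [← hqq]; ring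
      _ ≤ (q : ℝ) ^ (1 - σ) * ((t / 2) ^ (-σ) * (5 * t)) := by
          refine mul_le_mul_of_nonneg_left ?_ hQ0
          exact mul_le_mul h1 h3 (by positivity) (by positivity)
      _ = (q : ℝ) ^ (1 - σ) * (5 * ((t / 2) ^ (-σ) * t)) := by ring
      _ ≤ (q : ℝ) ^ (1 - σ) * (5 * (2 * t ^ (1 - σ))) := by gcongr
      _ = 10 * (q : ℝ) ^ (1 - σ) * t ^ (1 - σ) := by ring
  -- head
  have hhead : ‖∑ n ∈ Finset.range N, χ ((n + 1 : ℕ) : ZMod q) * ((n + 1 : ℕ) : ℂ) ^ (-s)‖ ≤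
      2 * (q : ℝ) ^ (1 - σ) * (1 + Real.log q) * L * t ^ (1 - σ) := by
    have hterm : ∀ n ∈ Finset.range N,
        ‖χ ((n + 1 : ℕ) : ZMod q) * ((n + 1 : ℕ) : ℂ) ^ (-s)‖ ≤ (N : ℝ) ^ (1 - σ) * (1 / ((n + 1 : ℕ) : ℝ)) := by
      intro n hn
      have hn1 : ((n + 1 : ℕ) : ℝ) ≤ N := by exact_mod_cast Finset.mem_range.1 hn
      have hn0 : (0 : ℝ) < ((n + 1 : ℕ) : ℝ) := by positivity
      rw [norm_mul, Complex.norm_natCast_cpow_of_pos (Nat.succ_pos n), Complex.neg_re, hsre]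
      have e : ((n + 1 : ℕ) : ℝ) ^ (-σ) = ((n + 1 : ℕ) : ℝ) ^ (1 - σ) * (1 / ((n + 1 : ℕ) : ℝ)) := by
        rw [one_div, ← Real.rpow_neg_one, ← Real.rpow_add hn0]; ring_nf
      rw [e]
      calc ‖χ ((n + 1 : ℕ) : ZMod q)‖ * (((n + 1 : ℕ) : ℝ) ^ (1 - σ) * (1 / ((n + 1 : ℕ) : ℝ)))
          ≤ 1 * (((n + 1 : ℕ) : ℝ) ^ (1 - σ) * (1 / ((n + 1 : ℕ) : ℝ))) :=
            mul_le_mul_of_nonneg_right (χ.norm_le_one _) (by positivity)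
        _ ≤ (N : ℝ) ^ (1 - σ) * (1 / ((n + 1 : ℕ) : ℝ)) := by
            rw [one_mul]
            exact mul_le_mul_of_nonneg_right (Real.rpow_le_rpow hn0.le hn1 (by linarith))
              (by positivity)
    have hNpow : (N : ℝ) ^ (1 - σ) ≤ (q : ℝ) ^ (1 - σ) * t ^ (1 - σ) := by
      rw [← Real.mul_rpow hq0.le ht0.le]
      exact Real.rpow_le_rpow hN0.le hNqt (by linarith)
    have hlogN : 1 + Real.log N ≤ 2 * (1 + Real.log q) * L := by
      have h1 : Real.log N ≤ Real.log q + L := by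
        rw [← Real.log_mul hq0.ne' ht0.ne']
        exact Real.log_le_log hN0 hNqt
      nlinarith
    calc ‖∑ n ∈ Finset.range N, χ ((n + 1 : ℕ) : ZMod q) * ((n + 1 : ℕ) : ℂ) ^ (-s)‖
        ≤ ∑ n ∈ Finset.range N, (N : ℝ) ^ (1 - σ) * (1 / ((n + 1 : ℕ) : ℝ)) :=
          (norm_sum_le _ _).trans (Finset.sum_le_sum hterm)
      _ = (N : ℝ) ^ (1 - σ) * ∑ n ∈ Finset.range N, 1 / ((n + 1 : ℕ) : ℝ) := by rw [Finset.mul_sum]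
      _ ≤ ((q : ℝ) ^ (1 - σ) * t ^ (1 - σ)) * (2 * (1 + Real.log q) * L) :=
          mul_le_mul hNpow ((VKFromRichert.sum_range_one_div_succ_le N).trans hlogN)
            (Finset.sum_nonneg fun n _ ↦ by positivity) (by positivity)
      _ = 2 * (q : ℝ) ^ (1 - σ) * (1 + Real.log q) * L * t ^ (1 - σ) := by ring
  have hL : ‖χ.LFunction s‖ ≤
      ‖χ.LFunction s - ∑ n ∈ Finset.range N, χ ((n + 1 : ℕ) : ZMod q) * ((n + 1 : ℕ) : ℂ) ^ (-s)‖ +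
        ‖∑ n ∈ Finset.range N, χ ((n + 1 : ℕ) : ZMod q) * ((n + 1 : ℕ) : ℂ) ^ (-s)‖ :=
    norm_le_norm_sub_add _ _
  have hX : 0 ≤ (q : ℝ) ^ (1 - σ) * t ^ (1 - σ) := by positivity
  have h10 : 10 * (q : ℝ) ^ (1 - σ) * t ^ (1 - σ) ≤
      10 * (q : ℝ) ^ (1 - σ) * (1 + Real.log q) * L * t ^ (1 - σ) := by
    have : (1 : ℝ) ≤ (1 + Real.log q) * L := by nlinarith
    nlinarith
  linarith

/-- **The crude exponent**: for `0 ≤ m`, `t ≥ 1`, `B ≥ 4`, and `m ≥ 1/16` or `t ≤ e^{300}`: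
`t^{m} ≤ 21 t^{B m^{3/2}}` (if `m ≥ 1/16` then `m ≤ 4m^{3/2}`; otherwise
`m − 4m^{3/2} ≤ 1/108` always, and `t^{1/108} ≤ e^{300/108} < 21`). [cite: Ford2002, Lemma 7.1 (proof)] -/
theorem rpow_crude_le {m t B : ℝ} (hm0 : 0 ≤ m) (ht : 1 ≤ t) (hB : 4 ≤ B)
    (hcase : 1 / 16 ≤ m ∨ t ≤ Real.exp 300) :
    t ^ m ≤ 21 * t ^ (B * m ^ (3 / 2 : ℝ)) := by
  have ht0 : 0 < t := by linarith
  set r : ℝ := Real.sqrt m with hr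
  have hr0 : 0 ≤ r := Real.sqrt_nonneg m
  have hr2 : r ^ 2 = m := by rw [hr]; exact Real.sq_sqrt hm0
  have hm32 : m ^ (3 / 2 : ℝ) = m * r := by
    rw [show (3 / 2 : ℝ) = 1 + 1 / 2 by norm_num, Real.rpow_add' hm0 (by norm_num), Real.rpow_one,
      hr, Real.sqrt_eq_rpow]
  have hm32' : 0 ≤ m ^ (3 / 2 : ℝ) := Real.rpow_nonneg hm0 _
  have hmono : t ^ (4 * m ^ (3 / 2 : ℝ)) ≤ t ^ (B * m ^ (3 / 2 : ℝ)) :=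
    Real.rpow_le_rpow_of_exponent_le ht (mul_le_mul_of_nonneg_right hB hm32')
  have h21 : 0 ≤ t ^ (B * m ^ (3 / 2 : ℝ)) := by positivity
  have h1t : 1 ≤ t ^ (B * m ^ (3 / 2 : ℝ)) := Real.one_le_rpow ht (by nlinarith)
  rcases hcase with hm16 | ht300
  · -- `m ≤ 4 m^{3/2}` since `√m ≥ 1/4`
    have hr4 : 1 / 4 ≤ r := by
      rw [hr]; exact Real.le_sqrt_of_sq_le (by nlinarith)  -- (1/4)^2 = 1/16 ≤ m
    have hle : m ≤ 4 * m ^ (3 / 2 : ℝ) := by rw [hm32]; nlinarith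
    calc t ^ m ≤ t ^ (4 * m ^ (3 / 2 : ℝ)) := Real.rpow_le_rpow_of_exponent_le ht hle
      _ ≤ t ^ (B * m ^ (3 / 2 : ℝ)) := hmono
      _ ≤ 21 * t ^ (B * m ^ (3 / 2 : ℝ)) := by nlinarith
  · -- `m − 4m^{3/2} ≤ 1/108`, `t^{1/108} ≤ e^{25/9} ≤ 21`
    have hpoly : m - 4 * m ^ (3 / 2 : ℝ) ≤ 1 / 108 := by
      rw [hm32, ← hr2]
      nlinarith [mul_nonneg (sq_nonneg (6 * r - 1)) (by linarith : 0 ≤ 12 * r + 1)]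
    have hsplit : t ^ m = t ^ (m - 4 * m ^ (3 / 2 : ℝ)) * t ^ (4 * m ^ (3 / 2 : ℝ)) := by
      rw [← Real.rpow_add ht0]; ring_nf
    have hsmall : t ^ (m - 4 * m ^ (3 / 2 : ℝ)) ≤ 21 := by
      calc t ^ (m - 4 * m ^ (3 / 2 : ℝ)) ≤ t ^ (1 / 108 : ℝ) := Real.rpow_le_rpow_of_exponent_le ht hpoly
        _ ≤ (Real.exp 300) ^ (1 / 108 : ℝ) := Real.rpow_le_rpow ht0.le ht300 (by norm_num)
        _ = Real.exp (300 / 108) := by rw [← Real.exp_mul]; norm_num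
        _ ≤ Real.exp 3 := Real.exp_le_exp.2 (by norm_num)
        _ ≤ 21 := by
            have h1 : Real.exp 1 < 2.7182818286 := Real.exp_one_lt_d9
            have e : Real.exp 3 = Real.exp 1 ^ 3 := by rw [← Real.exp_nat_mul]; norm_num
            rw [e]
            have h0 : 0 ≤ Real.exp 1 := (Real.exp_pos 1).le
            have := pow_le_pow_left₀ h0 h1.le 3
            nlinarith
    rw [hsplit]
    calc t ^ (m - 4 * m ^ (3 / 2 : ℝ)) * t ^ (4 * m ^ (3 / 2 : ℝ)) ≤ 21 * t ^ (B * m ^ (3 / 2 : ℝ)) :=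
        mul_le_mul hsmall hmono (by positivity) (by norm_num)

/-! ### The Richert-type bounds -/

/-- **The Richert-type bound for `L(s, χ)` from the exponential-sum estimate** (`χ ≠ χ₀`, `t ≥ 3`,
`1/2 ≤ σ ≤ 1`): `|L(σ + it, χ)| ≤ (252 + 4C) q^{1−σ}(1 + log q) t^{B(1−σ)^{3/2}} log t`,
`B = max(4.45, B_D)` (main range `norm_LFunction_le_main`; crude ranges `norm_LFunction_le_crude`
with `rpow_crude_le`). [cite: Ford2002, Lemma 7.3 and Corollary 2A] -/
theorem norm_LFunction_le_of_expSumBound {C D : ℝ} (h : ExpSumBound C D) (hC : 0 ≤ C)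
    (hD : 0 < D) {q : ℕ} [NeZero q] (χ : DirichletCharacter ℂ q) (hχ : χ ≠ 1) {σ t : ℝ}
    (ht : 3 ≤ t) (hσ : 1 / 2 ≤ σ) (hσ1 : σ ≤ 1) :
    ‖χ.LFunction (σ + t * I)‖ ≤ (252 + 4 * C) * (q : ℝ) ^ (1 - σ) * (1 + Real.log q) *
      t ^ (max 4.45 (Bexp D) * (1 - σ) ^ (3 / 2 : ℝ)) * Real.log t ^ (1 : ℝ) := by
  set B : ℝ := max 4.45 (Bexp D) with hBdef
  have hB4 : 4 ≤ B := le_trans (by norm_num) (le_max_left _ _)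
  have hBD : Bexp D ≤ B := le_max_right _ _
  have ht1 : 1 ≤ t := by linarith
  have ht0 : 0 < t := by linarith
  set m : ℝ := 1 - σ with hmdef
  have hm0 : 0 ≤ m := by rw [hmdef]; linarith
  have hm32 : 0 ≤ m ^ (3 / 2 : ℝ) := Real.rpow_nonneg hm0 _
  have hq0 : (0 : ℝ) < q := by exact_mod_cast NeZero.pos q
  have hlogq : 0 ≤ Real.log q := Real.log_natCast_nonneg q
  set L : ℝ := Real.log t with hLdef
  have hL1 : 1 ≤ L := by
    rw [hLdef, ← Real.log_exp 1]
    exact Real.log_le_log (Real.exp_pos 1) (by have := Real.exp_one_lt_d9; linarith)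
  rw [Real.rpow_one]
  set Q : ℝ := (q : ℝ) ^ (1 - σ) * (1 + Real.log q) with hQdef
  have hQ0 : 0 ≤ Q := by positivity
  set X : ℝ := t ^ (B * m ^ (3 / 2 : ℝ)) with hXdef
  have hX0 : 0 ≤ X := by positivity
  have hmono : t ^ (Bexp D * m ^ (3 / 2 : ℝ)) ≤ X :=
    Real.rpow_le_rpow_of_exponent_le ht1 (mul_le_mul_of_nonneg_right hBD hm32)
  by_cases hcase : σ ≤ 15 / 16 ∨ t ≤ Real.exp 300
  · have hcr := norm_LFunction_le_crude χ hχ hσ hσ1 ht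
    have hcase' : 1 / 16 ≤ m ∨ t ≤ Real.exp 300 := by
      rcases hcase with h1 | h2
      · left; rw [hmdef]; linarith
      · right; exact h2
    have hexp := rpow_crude_le hm0 ht1 hB4 hcase'
    calc ‖χ.LFunction (σ + t * I)‖ ≤ 12 * (q : ℝ) ^ (1 - σ) * (1 + Real.log q) * L * t ^ m := hcr
      _ = 12 * Q * L * t ^ m := by rw [hQdef]; ring
      _ ≤ 12 * Q * L * (21 * X) := by gcongr
      _ = 252 * Q * X * L := by ring
      _ ≤ (252 + 4 * C) * Q * X * L := by
          have : 0 ≤ 4 * C * Q * X * L := by positivity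
          nlinarith
      _ = (252 + 4 * C) * (q : ℝ) ^ (1 - σ) * (1 + Real.log q) * X * L := by rw [hQdef]; ring
  · rw [not_or, not_le, not_le] at hcase
    obtain ⟨hσ15, ht300⟩ := hcase
    have hmain := norm_LFunction_le_main h hC hD χ hχ hσ15.le hσ1 ht300.le
    calc ‖χ.LFunction (σ + t * I)‖
        ≤ (23 + 4 * C) * (q : ℝ) ^ (1 - σ) * (1 + Real.log q) * t ^ (Bexp D * m ^ (3 / 2 : ℝ)) * L := hmain
      _ = (23 + 4 * C) * Q * t ^ (Bexp D * m ^ (3 / 2 : ℝ)) * L := by rw [hQdef]; ring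
      _ ≤ (252 + 4 * C) * Q * X * L := by gcongr; linarith
      _ = (252 + 4 * C) * (q : ℝ) ^ (1 - σ) * (1 + Real.log q) * X * L := by rw [hQdef]; ring

/-- **Negative heights** by conjugation: `‖L(σ − it, χ)‖ = ‖L(σ + it, χ̄)‖` (`χ ≠ χ₀`;
`DirichletZFR.conj_LFunction_conj`). [folklore] -/
theorem norm_LFunction_neg_height {q : ℕ} [NeZero q] (χ : DirichletCharacter ℂ q) (hχ : χ ≠ 1)
    (σ t : ℝ) :
    ‖χ.LFunction (σ + (((-t : ℝ) : ℂ)) * I)‖ = ‖χ⁻¹.LFunction (σ + t * I)‖ := by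
  have h := DirichletZFR.conj_LFunction_conj χ hχ ((σ : ℂ) + t * I)
  have hconj : (starRingEnd ℂ) ((σ : ℂ) + t * I) = (σ : ℂ) + ((-t : ℝ) : ℂ) * I := by
    apply Complex.ext <;> simp
  rw [hconj] at h
  rw [← h, Complex.norm_conj]

/-- **`ExpSumBound C D ⟹ RichertTypeBoundL (252 + 4C) (max(4.45, B_D)) 1`**: the Richert-type bound
(with `log t` to the first power) for all non-principal `L(s, χ)`, uniformly in `q`.
[cite: Ford2002, Lemma 7.3 and Corollary 2A] -/
theorem richertTypeBoundL_of_expSumBound {C D : ℝ} (h : ExpSumBound C D) (hC : 0 ≤ C)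
    (hD : 0 < D) : RichertTypeBoundL (252 + 4 * C) (max 4.45 (Bexp D)) 1 := by
  intro q _ χ hχ σ t ht hσ hσ1
  rcases le_or_gt 0 t with h0 | h0
  · rw [abs_of_nonneg h0] at ht ⊢
    exact norm_LFunction_le_of_expSumBound h hC hD χ hχ ht hσ hσ1
  · have ht' : 3 ≤ -t := by rwa [abs_of_neg h0] at ht
    have key := norm_LFunction_le_of_expSumBound h hC hD χ⁻¹ (inv_ne_one.2 hχ) ht' hσ hσ1
    have e : (t : ℂ) = (((- -t : ℝ)) : ℂ) := by push_cast; ring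
    rw [e, norm_LFunction_neg_height χ hχ σ (-t), abs_of_neg h0]
    exact key

/-- **`ExpSumBound C D ⟹ RichertTypeBound (252 + 4C) (max(4.45, B_D)) 1`** for `ζ`
(`norm_zeta_le_of_expSumBound`, `77 + 2C ≤ 252 + 4C`, and `|ζ(σ − it)| = |ζ(σ + it)|`).
[cite: Ford2002, Lemma 7.3] -/
theorem richertTypeBound_of_expSumBound {C D : ℝ} (h : ExpSumBound C D) (hC : 0 ≤ C)
    (hD : 0 < D) : RichertTypeBound (252 + 4 * C) (max 4.45 (Bexp D)) 1 := by
  have hpos : ∀ σ t : ℝ, 3 ≤ t → 1 / 2 ≤ σ → σ ≤ 1 →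
      ‖riemannZeta (σ + t * I)‖ ≤ (252 + 4 * C) * t ^ (max 4.45 (Bexp D) * (1 - σ) ^ (3 / 2 : ℝ)) *
        Real.log t ^ (1 : ℝ) := by
    intro σ t ht hσ hσ1
    refine (norm_zeta_le_of_expSumBound h hC hD ht hσ hσ1).trans ?_
    have ht1 : 1 ≤ t := by linarith
    have hlog : 0 ≤ Real.log t ^ (1 : ℝ) := Real.rpow_nonneg (Real.log_nonneg ht1) _
    have : 0 ≤ t ^ (max 4.45 (Bexp D) * (1 - σ) ^ (3 / 2 : ℝ)) * Real.log t ^ (1 : ℝ) := by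
      positivity
    nlinarith
  intro σ t ht hσ hσ1
  rcases le_or_gt 0 t with h0 | h0
  · rw [abs_of_nonneg h0] at ht ⊢
    exact hpos σ t ht hσ hσ1
  · have ht' : 3 ≤ -t := by rwa [abs_of_neg h0] at ht
    have key := hpos σ (-t) ht' hσ hσ1
    rw [norm_riemannZeta_ofReal_add_neg_mul_I] at key
    rwa [abs_of_neg h0]

end RichertFromExpSum

open RichertFromExpSum in
/-- **The Vinogradov–Korobov zero-free region from Vinogradov's exponential-sum estimate.**  If
`ExpSumBound C D` (`C ≥ 0`, `D > 0`: `‖∑_{N<n≤R}(n + u)^{-it}‖ ≤ C N^{1 − (log N)²/(D log² t)}` for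
`1 ≤ N < R ≤ 2N`, `N ≤ t`, `0 < u ≤ 1` — Ford's Theorem 2 with unspecified constants), then
`∃ c > 0, HasVKZeroFreeRegion c 21`: `L(σ + it, χ) ≠ 0` for all `q ≥ 3`, `χ` mod `q`, `|t| ≥ 21`,
`σ ≥ 1 − c/(log q + (log|t|)^{2/3}(log log|t|)^{1/3})` (`richertTypeBound(L)_of_expSumBound` and
`hasVKZeroFreeRegion_of_richertType`). [cite: Ford2002, Theorem 2 and Lemma 7.3]
[cite: Khale2024, (1.4) and Theorem B.1] -/
theorem hasVKZeroFreeRegion_of_expSumBound {C D : ℝ} (h : ExpSumBound C D) (hC : 0 ≤ C)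
    (hD : 0 < D) : ∃ c : ℝ, 0 < c ∧ HasVKZeroFreeRegion c 21 :=
  hasVKZeroFreeRegion_of_richertType (richertTypeBound_of_expSumBound h hC hD)
    (richertTypeBoundL_of_expSumBound h hC hD) zero_le_one

open RichertFromExpSum in
/-- **The Vinogradov–Korobov zero-free region for `ζ` from Vinogradov's exponential-sum estimate**:
`ExpSumBound C D ⟹ ∃ c > 0`, `ζ(σ + it) ≠ 0` for `|t| ≥ 21`,
`σ ≥ 1 − c/((log|t|)^{2/3}(log log|t|)^{1/3})`. [cite: Ford2002, Theorem 2 and Lemma 7.3]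
[cite: Titchmarsh1986, Theorem 3.10 and §6.19] -/
theorem zeta_zeroFree_of_expSumBound {C D : ℝ} (h : ExpSumBound C D) (hC : 0 ≤ C) (hD : 0 < D) :
    ∃ c : ℝ, 0 < c ∧ ∀ s : ℂ, 21 ≤ |s.im| →
      1 - c / (Real.log |s.im| ^ (2 / 3 : ℝ) * Real.log (Real.log |s.im|) ^ (1 / 3 : ℝ)) ≤ s.re →
        riemannZeta s ≠ 0 :=
  VKFromRichert.zeta_zeroFree_of_richertType (richertTypeBound_of_expSumBound h hC hD) zero_le_one

end Literature.NumberTheory.LFunctions
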